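import Summits.CriticalPhenomena.SAWScalingLimit.Theses.SAWLoopFugacityFlow
import Literature.Probability.RandomPlanarGeometry.SAWParafermion
import Literature.Probability.RandomPlanarGeometry.SAWScalingLimitFamily
import Literature.Probability.RandomPlanarGeometry.SAWSideProbability
import Literature.Probability.RandomPlanarGeometry.SimpleCurves
import Literature.Probability.Percolation.CLE6Proofs
import Literature.Probability.RandomPlanarGeometry.ConformalRestrictionProofs
import Literature.Probability.RandomPlanarGeometry.CaratheodoryHalfPlaneProofs
import Literature.Probability.RandomPlanarGeometry.CritPercSLESimplePathHolds
import Literature.Probability.RandomPlanarGeometry.LocalMartingaleProofs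
import Summits.CriticalPhenomena.SAWScalingLimit.Theses.SAWSteinDefect
import Summits.CriticalPhenomena.SAWScalingLimit.Theses.SAWTensorRG
import Summits.CriticalPhenomena.SAWScalingLimit.Theses.SAWFrontierHomotopy
import Literature.Probability.RandomPlanarGeometry.SelfAvoidingWalkProofs
import Literature.Probability.RandomPlanarGeometry.SLEConvergenceCriterion
import Literature.Barriers.CriticalPhenomena.SupercriticalSAWSpaceFillingFilamentsCusp
import Literature.Barriers.CriticalPhenomena.SupercriticalSAWSpaceFillingUnconditional
import Summits.CriticalPhenomena.SAWScalingLimit.Cruxes.SimpleSubseqLimits.DrefuteReshapedStubs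

/-!
# Disproof of `SimpleSubseqLimits` — standing adversary's work file
(crux item stmt-CriticalPhenomena-4982; decl
`Summit.CriticalPhenomena.SAWScalingLimit.Theses.SAWLoopFugacityFlow.SimpleSubseqLimits`, shared
verbatim by the routes SAWSteinDefect / SAWTensorRG / SAWFrontierHomotopy; refuter `cdisprove`,
gen 1 (§1–§10), gen 2 (§11–§14) and gen 3 (§15–§16, aimed at the PICKED line `marked-point-revisit`).
Everything below is `lean check`ed and sorry-free — there is no NEAR-MISS: nothing refutable was found
short of disproving the summit conjunct itself, see §3.)

CRUX (read-back, §0). `S := ∀ D (a b : ℝ → Site 2), IsEndpointApprox D a b → ∀ s ν,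
s → 0⁺ → IsProbabilityMeasure ν → (∀ f : CurveClass ℂ →ᵇ ℝ, ∫ f ∘ curve dP_{s n} → ∫ f dν) →
ν-a.e. γ : γ ∈ simple ∧ γ.source = a ∧ γ.target = b ∧ γ.range ⊆ cl D ∧ γ.range ∩ ∂D ⊆ {a, b}`,
`P_δ = SAW.law D.carrier δ (a δ) (b δ)` the critical `δℤ²` SAW law (`x_c = 1/μ`).

VERDICT SO FAR: NOT REFUTED, and not refutable by typing artefacts (§1: every junk regime of
`SAW.law` makes the hypotheses of `S` FAIL, never its conclusion). See the module sections:

* §1 HONESTY — `law_univ_eq_zero_or_one`, `eventually_isProbabilityMeasure_of_tendsto`: the weak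
  convergence hypothesis of `S` forces `P_{s n}` to be a probability measure (hence `a (s n)`,
  `b (s n)` joined in `Ω_{s n}`) for all large `n`; the field `IsEndpointApprox.reachable` is idle.
* §2 LOAD-BEARING HYPOTHESES — `simpleSubseqLimits_false_without_tendsto_fst/snd`: dropping either
  endpoint-limit field of `IsEndpointApprox` makes `S` FALSE for EVERY Dobrushin domain (coincident
  endpoints `a δ = b δ = nearestSite δ (D.pt i)`: the law is the Dirac mass at the trivial walk, the
  limit `ν` is the Dirac mass at a CONSTANT curve, which is not simple). Any proof must use both
  `tendsto_fst` and `tendsto_snd` — already for the simplicity clause alone.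
* §3 WHY IT RESISTS — `exists_subseqLimit_of_not`: a disproof of `S` must CONSTRUCT a subsequential
  weak limit of critical SAW (none is known: tightness at `x_c` is open);
  `not_sawScalingLimit_of_not`: `¬ S → ¬ SAWScalingLimit` (with `SLECarrier` PROVED here from the
  tree, `sleCarrier_holds`): refuting the crux refutes the summit conjunct itself (LSW Prediction 1
  as typed); `not_subseqIdentification_of_not`: `¬ S → ¬ SubseqIdentification`.
* §4 THE SOFT ROAD IS CLOSED — `simple_not_isClosed`: `CurveClass.simple` is not (sequentially)
  closed (explicit injective curves `overshoot t + i t/(n+1)` converging to the non-flat real curve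
  `0 → 3 → 2`), and `exists_weakLimit_not_ae_simple`: Dirac masses at simple classes converge weakly to
  a probability measure giving mass `0` to `simple`. Simplicity of `ν` needs quantitative SAW input.
* §5 FREE CLAUSES — `ae_source_target_range_of_subseqLimit`: for EVERY subsequential limit `ν` as in
  `S`, `ν`-a.e. `source = a`, `target = b`, `range ⊆ cl D` (continuity of the endpoints, portmanteau
  for the closed event `rangeSubset (closure D)`); hence `crux_iff_core`: `S` ⟺ its two genuine
  clauses `simple` ∧ `range ∩ ∂D ⊆ {a, b}`.
* §6 IDLE HYPOTHESIS — `crux_iff_withoutReachable`: `S` ⟺ `S` with `IsEndpointApprox.reachable`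
  dropped (repair the approximation off the sequence by `SAW.exists_isEndpointApprox`); no
  `_false_without_reachable` theorem can exist.
* §7 RANGE-BLINDNESS (tightness of the decomposition) — `exists_simple_and_not_simple_same_range`:
  the unit-disc diameter traversed once (`diam`) and with a Z-fold (`zig`) have the same range and
  endpoints, one simple, one not; hence `avoidanceDeterminesLaw_false_without_simple`: the consumer
  `AvoidanceDeterminesLaw` (stmt-1373) with the simplicity clause dropped is FALSE (Dirac masses at
  `diam`/`zig` agree on every avoidance event). The simplicity clause of `S` is exactly what the
  assembly needs and no avoidance/range functional can replace it ("range data never see the clock").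

* §8 NON-VACUITY MODULO TIGHTNESS — `exists_weakLimitAlong_of_eventualTight`: under `EventualTight`
  (stmt-1372, wanted by all four routes) every sequence `s n → 0⁺` has a subsequence along which the
  SAW laws converge weakly to a probability measure (Prokhorov, clamped laws): the hypotheses of `S`
  are satisfiable at every `(D, a, b)`, so `S` is a genuine constraint exactly in the routes' regime
  (and vacuous exactly where tightness fails). Honest laws: `eventually_isProbabilityMeasure_law`.

* §9 CRITICALITY IS LOAD-BEARING — `CruxAt x` (the crux with `lawAt x`): for every `x > x_c`,
  every subsequential weak limit of the parameter-`x` SAW in `(𝔻; 1, -1)` is a.s. ONTO the disc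
  (`ae_unitDisk_subset_range_of_supercritical_weakLimit`, from DKY 2014 Thm 1 proved in the tree
  and the portmanteau mechanism of the barrier file) hence not simple
  (`not_ae_simple_of_supercritical_weakLimit`); so `CruxAt x` is FALSE as soon as one
  supercritical subsequential limit exists (`cruxAt_false_of_supercritical_limit`) and can hold
  only vacuously (`no_supercritical_limit_of_cruxAt`). A proof of `S` must use `x = x_c`.

* §10 NO FINITE-MESH VERSION — `curve_source_ne_pt`, `eventually_forall_not_carrier`: at every
  positive mesh NO approximant satisfies the carrier clause (walks start at interior mesh points);
  the clause is a pure limit phenomenon, reached only through convergence of the mesh points.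

* §11 (gen 2) `IsProbabilityMeasure ν` IS IDLE — `isProbabilityMeasure_of_weakLimitAlong`,
  `crux_iff_withoutIsProbability`: the weak-limit hypothesis with test function `1` forces
  `ν univ = 1` (Lean's `∫ 1 dν = ν.real univ` for every measure); BUT it is JOINTLY load-bearing with
  `reachable`: `crux_false_without_isProbability_and_reachable` (endpoint one step OUTSIDE the disc ⇒
  all laws `0`; `ν = ∞ • δ_const` has all test integrals `0` by the junk value of `∫ · ∂(∞ • μ)`).
* §12 (gen 2) THE MESH HYPOTHESIS `s n → 0⁺` IS LOAD-BEARING IN BOTH PARTS —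
  `crux_false_without_meshLimit` (only `0 < s n`: `s ≡ δ₁`, the limit is the honest law at mesh `δ₁`,
  whose curves start at an interior mesh point), `crux_false_with_twoSidedMeshLimit` (`𝓝 0` instead
  of `𝓝[>] 0`: negative meshes, where `IsEndpointApprox` says nothing), `crux_false_without_weakLimit`;
  assembled with §2/§6 into `crux_hypothesis_ledger`: EVERY one-hypothesis weakening of `S` is now
  classified (equivalent: drop `reachable`, drop `IsProbabilityMeasure`; false: all others).
* §13 (gen 2) INTERIOR ROOTS ARE IN THE QUANTIFIER — `exists_isEndpointApprox_interior`: every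
  Dobrushin domain has an `IsEndpointApprox` whose two roots are INTERIOR vertices of `Ω_δ` (degree 4)
  for all small `δ`; so the crux (and the summit) cover walks whose first step leaves an ISLAND past
  (doubly connected slit domain, KS admissibility of stmt-11346 fails): every KS-fed line
  (capacity-clock cards, hugging-release, past-shadowing) needs an explicit interior-root reduction —
  triage finding F2 (TRIAGE-r1-2) as a checked fact; `CruxInteriorRooted`, `cruxInteriorRooted_of_crux`.
* §14 (gen 2) PRE-KILL — `not_densePastFutureLemma`: the typed first lemma
  `simple_of_dense_pastFuture` of card slit-continuous-restriction (Ideator3Sketch) is FALSE (constant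
  curve, `T = univ`); repair: add `γ 0 ≠ γ 1`. The other typed deterministic lemmas of round 1
  (`ArcClock`, `simple_of_arc_range_of_strictGrowth` [proved by its author],
  `mk_mem_simple_of_eq_comp_monotone`, `carrier_of_shape_of_order`, `Shadowing`) survive on paper
  (`CurveClass` = separation quotient of the reparametrisation pseudometric). The typed LATTICE inputs
  `UnforcedCrossingBound` / `BoundaryApproachBound` (∃ C) resist cheap kills: vacuous avoidability
  (consecutive indices) only forces `C > 2`; two avoidable through-channels are impossible in a Jordan
  `Ω_δ` (a lattice loop in `Ω̄` encloses only points of `Ω`, so both channels lie in one component of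
  the annulus sites); entropy traps lose to `x_c^{2(C-1)r/δ}` for large `C`. Their WIDENING to
  arbitrary finite induced subgraphs / island pasts IS false on paper (RING ROAD, TRIAGE-r1-2 F2/F3):
  `S = ({-1..m+1} × {0..3}) ∖ ({0..m} × {2})` — a rectangle minus a straight ISLAND PAST — with
  `a = (-1,0)`, `b = (m+1,0)`, `z₀ = (m/2, 1/2)`, `r = δ`, `R = C δ`, `m` even `≥ 2C`: every SAW `a → b`
  avoiding row `3` is a 2-row-ladder traversal through the middle column, an UNFORCED crossing of
  `A(z₀; r, R)` (its annulus arm is graph-avoidable through the corridor row `3`), and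
  `P(ladder) ≥ 1/(1 + x²) ≥ 4/5` for `x = x_c ≤ 1/2` (`criticalFugacity_le_half`) by a
  classification-light injection: the corridor vertices have degree `2`, so a corridor walk is
  `prefix(k) · corridor · suffix(k')` with ladder excursions of depths `k, k' ∈ {none} ∪ {0..m}`, and
  `(k,k') ↦` the ladder walk with rung-switch set `∅ / {k,k+1} / {-1,k'} / {-1,k,m-k',m+1}` is injective
  and shortens by `≥ 2` steps (ladder walk of switch set `T` has length `m+2+|T|`, corridor walk has
  length `m+8+(2k+2)+(2k'+2)`). Hence the widened bound fails for EVERY `C`. EXACT ENUMERATION (kit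
  job j011445, all SAWs `a → b`, weights `x^{#steps}`, `x ∈ {1/3, x_c = 1/2.63815853, 2/5, 1/2}`):
    ring road `m = 2, 4, 6, 8, 10` (`C ≤ m/2+1 = 2..6`): `#SAW = 26, 85, 292, 1079, 4174`;
    `P(ladder) at x_c = 0.9984, 0.9992, 0.9996, 0.9998, 0.9999` (at `x = 1/2`: `≥ 0.9929`) — the
    unforced crossing has probability `→ 1`, not `≤ 1/2`.
  CONTROLS in simply connected boxes (same job): `n × n` box, top-left → top-right corner, `z₀` the
  bottom-middle boundary point, `P(visit a site within r = 1 of z₀)` at `x_c` = `0.0472 (n=4, 178 SAWs)`,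
  `0.0274 (n=5, 8590)`, `0.0239 (n=6, 1 246 850)` (at `x = 1/2`: `0.161, 0.142, 0.182`); `P(visit the
  bottom row)` at `x_c` = `0.047, 0.035, 0.027`; outward excursion `a = (-1,0) → b = (1,0)` in `[-2,2]²`,
  `P(reach sup-norm 2)` = `0.257` at `x_c` (`0.549` at `x = 1/2`: the certified range `x_c ∈ [1/3,1/2]`
  alone does not decide this `C = 2` instance in Lean). So at lattice scale the boundary-centred bound of
  `BoundaryApproachBound` holds with a wide margin in boxes, and fails exactly where simple connectivity
  fails. To be made a checked `_false` theorem as soon as a line TYPES a domain-Markov / G-bound stub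
  over non-simply-connected site sets or island pasts (next target; the formal cost is the degree-2
  corridor classification).

* §15 (gen 3, line `marked-point-revisit`) ORDER IS BLIND TO KISSES — `exists_noMarkedRevisitFor_not_ae_simple`:
  the line's ORDER clause `NoMarkedRevisitFor` (output of stubs 4–5, VERBATIM the skeleton's predicate, imported
  from the drefuter's `DrefuteReshapedStubs`) HOLDS for the Dirac mass at the KISS class (`kiss`: polygon
  `0 → 2 → 2+i → 1 → i`, touching its first edge at the single point `1` from above: one double pair
  `kiss (1/8) = kiss (3/4)`, `kissAt_eq_kissAt`; no retrace, no crossing), which is a LIMIT OF SIMPLE classes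
  (`mk_kiss_mem_closure_simple`, via the injective polygons `kissAt h`, `h ↓ 0`) and NOT simple
  (`mk_kiss_not_mem_simple`). The marked-point functional only ever sees exact revisits `γ t' = γ lam` of an
  entrance point; at a kiss this happens on the codimension-one parameter set `{dist 1 z = R}` only, so a dense
  `S` avoiding it exists (`noMarkedRevisitFor_dirac_kiss`). Mirror of §7: there SHAPE without ORDER failed
  (`diam`/`zig`), here ORDER without SHAPE fails. Since transversal self-CROSSINGS are not uniform limits of
  simple planar curves while kisses and retraces are, the non-simple classes a SAW limit can charge are retraces
  (ORDER catches them) and kisses (only SHAPE = `RangeIsArc` does: a kiss range contains a loop). CONSEQUENCE: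
  in this line `AvoidanceLimit` (feeding `stub_rangeIsArc`) is load-bearing for SIMPLICITY itself, not only for
  the boundary clause; no `OnePointNoTouch`-type input can replace it.
* §16 (gen 3) NO STRENGTH WASTED — `ae_hasArcRange_of_crux` (`S` ⇒ the SHAPE clause `HasArcRange` a.e., the
  class itself being the chord) and `noTouchAt_of_crux_of_eventualTight`: `S ∧ EventualTight ⇒ NoTouchAt` along
  every endpoint approximation (contradiction scheme: meshes `δ_n < 1/(n+1)` with `P_{δ_n}(E_n) > θ` from
  `frequently_lt_of_lt_limsup`, a convergent subsequence by §8 `exists_weakLimitAlong_of_eventualTight`, closed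
  enlargements charged `≥ θ` by portmanteau, their intersection null under a simple-carried `ν` by the drefuter's
  `not_mem_closure_nearRevisitEvent_forall_of_simple`). With `noTouchAt_of_sawScalingLimit` (drefute) the hardest
  stub is pinned between `S + T` and the summit: exactly as hard as the ORDER half of the crux in the tight regime.
* REMARK (gen 3, paper only) LEFT CRITICALITY. §9 pins `x ≤ x_c` through the simplicity clause (supercritical
  limits are onto). On the LEFT, `x < x_c`, fixed-endpoint SAW is short (`…SubcriticalLength`, PROVED: length
  `≤ C(x)/δ` w.h.p.) and its limits are thin; the conjectural limit is the taut geodesic (Ioffe/OZ), which in a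
  NON-convex Jordan domain runs along a reflex stretch of `∂D`: there the BOUNDARY clause of `CruxAt x` fails
  while simplicity survives — the two genuine clauses of `S` (§5) are pinned to `x_c` from opposite sides. Not
  typed: needs a non-convex `JordanDomain` instance and a constrained large-deviation (taut-string) theorem.

LANDED (Theorems/SimpleSubseqLimits/Negative/, all `--supports stmt-CriticalPhenomena-4982`):
`SimpleSubseqLimitsHonesty` (§0–1, p73596 ACCEPTED), `SimpleSubseqLimitsFalseWithoutEndpointLimits`
(§2, p73992 ACCEPTED), `SimpleSubseqLimitsNecessary` (§3, p73594 ACCEPTED),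
`SimpleSubseqLimitsSimpleNotClosed` (§4, p73589 ACCEPTED), `SimpleSubseqLimitsCore` (§5–6, p74405
ACCEPTED), `SimpleSubseqLimitsRangeBlind` (§7, p74553 ACCEPTED), `SimpleSubseqLimitsCriticality`
(§9, p74329 ACCEPTED) — all seven landed; gen 2: `SimpleSubseqLimitsHypothesisLedger` (§10–§12,
statements inline, p77031 ACCEPTED) and `SimpleSubseqLimitsInteriorRoots` (§13–§14, p77662 ACCEPTED).
§8 lives in this work file only (its honest-law lemma is the sibling
`SubseqIdentification.Negative.eventually_isProbabilityMeasure_law`, reused by the ledger file).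
NOTE FOR LATER SEATS: the gate relocates `def X : Prop` from Theorems files to Literature (bounce) —
land weakened statements INLINE in theorem types; keep the named `CruxWithout…` defs in this work file.
`SLECarrier` candidate proof attached as evidence to stmt-4985; §7 evidence note on stmt-1373.
-/

noncomputable section

open MeasureTheory Filter Topology Set Metric
open Literature.Probability.RandomPlanarGeometry Literature.Probability.RandomPlanarGeometry.SAW
open Literature.Probability.LatticeModels Literature.Probability.Percolation
open scoped ENNReal NNReal BoundedContinuousFunction

namespace Summit.CriticalPhenomena.SAWScalingLimit.Cruxes.SimpleSubseqLimits.Disproof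

/-- The crux under attack (route decl, shared body). -/
abbrev Crux : Prop :=
  Summit.CriticalPhenomena.SAWScalingLimit.Theses.SAWLoopFugacityFlow.SimpleSubseqLimits

/-- The full carrier predicate of the crux's conclusion. -/
def Carrier (D : DobrushinDomain) (γ : CurveClass ℂ) : Prop :=
  γ ∈ CurveClass.simple ∧ γ.source = D.pt 0 ∧ γ.target = D.pt 1 ∧
    γ.range ⊆ closure D.carrier ∧ γ.range ∩ frontier D.carrier ⊆ {D.pt 0, D.pt 1}

/-- The weak-convergence hypothesis of the crux along a sequence of meshes. -/
def WeakLimitAlong (D : DobrushinDomain) (a b : ℝ → Site 2) (s : ℕ → ℝ)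
    (ν : Measure (CurveClass ℂ)) : Prop :=
  ∀ f : CurveClass ℂ →ᵇ ℝ,
    Tendsto (fun n => ∫ γ, f γ.curve ∂(law D.carrier (s n) (a (s n)) (b (s n)))) atTop
      (𝓝 (∫ x, f x ∂ν))

/-- Read-back: the crux, restated with the abbreviations of this file (definitional). -/
theorem crux_iff : Crux ↔ ∀ (D : DobrushinDomain) (a b : ℝ → Site 2), IsEndpointApprox D a b →
    ∀ (s : ℕ → ℝ) (ν : Measure (CurveClass ℂ)), Tendsto s atTop (𝓝[>] (0 : ℝ)) →
      IsProbabilityMeasure ν → WeakLimitAlong D a b s ν → ∀ᵐ γ ∂ν, Carrier D γ :=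
  Iff.rfl

/-! ## §1 Honesty of the laws along a weakly convergent sequence -/

section Honesty

variable {Ω : Set ℂ} {δ : ℝ} {a b : Site 2}

/-- Singletons of the discrete type of SAWs are measurable. -/
instance : MeasurableSingletonClass (DomainSAW Ω δ a b) := ⟨fun _ => MeasurableSpace.measurableSet_top⟩

/-- The critical SAW law has total mass `0` (junk: no SAW, or infinite partition function) or `1`. -/
theorem law_univ_eq_zero_or_one (Ω : Set ℂ) (δ : ℝ) (a b : Site 2) :
    law Ω δ a b univ = 0 ∨ law Ω δ a b univ = 1 := by
  rw [law, Measure.smul_apply, smul_eq_mul]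
  rcases eq_or_ne (weight Ω δ a b univ) 0 with h0 | h0
  · left; rw [h0, mul_zero]
  rcases eq_or_ne (weight Ω δ a b univ) ∞ with ht | ht
  · left; rw [ht, ENNReal.inv_top, zero_mul]
  · right; exact ENNReal.inv_mul_cancel h0 ht

/-- The critical SAW law is a finite measure (total mass `≤ 1`). -/
instance isFiniteMeasure_law (Ω : Set ℂ) (δ : ℝ) (a b : Site 2) :
    IsFiniteMeasure (law Ω δ a b) :=
  ⟨(law_apply_le_one Ω δ a b univ).trans_lt ENNReal.one_lt_top⟩

/-- The law is a probability measure as soon as its total mass is not `0`. -/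
theorem isProbabilityMeasure_law_of_ne_zero (h : law Ω δ a b univ ≠ 0) :
    IsProbabilityMeasure (law Ω δ a b) :=
  ⟨(law_univ_eq_zero_or_one Ω δ a b).resolve_left h⟩

/-- A nonzero law charges some SAW, so the endpoints are joined in `Ω_δ`. -/
theorem reachable_of_law_ne_zero (h : law Ω δ a b univ ≠ 0) :
    (discreteDomainGraph Ω δ).Reachable a b := by
  by_contra hr
  have : IsEmpty (DomainSAW Ω δ a b) := ⟨fun γ => hr ⟨γ.walk⟩⟩
  exact h (by rw [Set.univ_eq_empty_iff.2 this, measure_empty])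

/-- **Honesty along the sequence.** If the SAW laws along `s n` converge weakly (on bounded
continuous test functions of the curve) to a probability measure, then for all large `n` the law
at mesh `s n` is a probability measure — so the endpoints `a (s n)`, `b (s n)` are joined in the
discrete domain. Consequently the field `IsEndpointApprox.reachable` is never used by `S` along
the sequence: it comes for free from the convergence hypothesis (test function `f ≡ 1`). -/
theorem eventually_isProbabilityMeasure_of_tendsto {D : DobrushinDomain} {a b : ℝ → Site 2}
    {s : ℕ → ℝ} {ν : Measure (CurveClass ℂ)} [IsProbabilityMeasure ν]
    (h : WeakLimitAlong D a b s ν) :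
    ∀ᶠ n in atTop, IsProbabilityMeasure (law D.carrier (s n) (a (s n)) (b (s n))) ∧
      (discreteDomainGraph D.carrier (s n)).Reachable (a (s n)) (b (s n)) := by
  have h1 := h 1
  have hl : (fun n => ∫ γ, (1 : CurveClass ℂ →ᵇ ℝ) γ.curve
      ∂(law D.carrier (s n) (a (s n)) (b (s n)))) =
      fun n => (law D.carrier (s n) (a (s n)) (b (s n)) univ).toReal := by
    funext n; simp [Measure.real]
  have hr : ∫ x, (1 : CurveClass ℂ →ᵇ ℝ) x ∂ν = 1 := by simp
  rw [hl, hr] at h1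
  -- the total masses are `0` or `1` and converge to `1`
  have hev : ∀ᶠ n in atTop,
      (law D.carrier (s n) (a (s n)) (b (s n)) univ).toReal ∈ Ioi (1 / 2 : ℝ) :=
    h1 (Ioi_mem_nhds (by norm_num))
  filter_upwards [hev] with n hn
  have hne : law D.carrier (s n) (a (s n)) (b (s n)) univ ≠ 0 := by
    intro h0
    rw [h0, ENNReal.toReal_zero, mem_Ioi] at hn
    norm_num at hn
  exact ⟨isProbabilityMeasure_law_of_ne_zero hne, reachable_of_law_ne_zero hne⟩

end Honesty

/-! ## §2 Load-bearing hypotheses: the two endpoint limits -/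

section LoadBearing

variable {Ω : Set ℂ} {δ : ℝ}

/-- At coincident endpoints the weight is the Dirac mass at the trivial walk. -/
theorem weight_self (Ω : Set ℂ) (δ : ℝ) (e : Site 2) :
    weight Ω δ e e = Measure.dirac (DomainSAW.nil e) := by
  ext s hs
  rw [weight, Measure.sum_apply _ hs, tsum_fintype, Finset.univ_unique, Finset.sum_singleton]
  simp [show (default : DomainSAW Ω δ e e) = DomainSAW.nil e from rfl]

/-- At coincident endpoints the critical SAW law is the Dirac mass at the trivial walk
(for EVERY `Ω`, `δ`, also for a vertex outside the discrete domain). -/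
theorem law_self (Ω : Set ℂ) (δ : ℝ) (e : Site 2) :
    law Ω δ e e = Measure.dirac (DomainSAW.nil e) := by
  rw [law, weight_self, Measure.dirac_apply_of_mem (mem_univ _), inv_one, one_smul]

/-- The curve of the trivial walk is the constant curve at the mesh point. -/
theorem toCurve_nil_apply (e : Site 2) (t : unitInterval) :
    (SimpleGraph.Walk.nil : (discreteDomainGraph Ω δ).Walk e e).toCurve (meshPoint δ) t =
      meshPoint δ e := by
  simp [SimpleGraph.Walk.toCurve, polyline]

/-- The curve class of the trivial walk is the class of the constant curve at the mesh point. -/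
theorem curve_nil (e : Site 2) :
    (DomainSAW.nil e : DomainSAW Ω δ e e).curve = CurveClass.mk (Curve.const (meshPoint δ e)) := by
  simp only [DomainSAW.curve, DomainSAW.nil]
  congr 1

/-- Test integrals against the law at coincident endpoints. -/
theorem integral_law_self (f : CurveClass ℂ →ᵇ ℝ) (e : Site 2) :
    ∫ γ, f γ.curve ∂(law Ω δ e e) = f (CurveClass.mk (Curve.const (meshPoint δ e))) := by
  rw [law_self, integral_dirac, curve_nil]

/-- Classes of constant curves are `dist`-close when the points are. -/
theorem dist_mk_const_le (p q : ℂ) :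
    dist (CurveClass.mk (Curve.const p)) (CurveClass.mk (Curve.const q)) ≤ dist p q := by
  rw [CurveClass.dist_mk_mk]
  refine (Curve.dist_le_dist_toContinuousMap _ _).trans ?_
  exact (ContinuousMap.dist_le dist_nonneg).2 fun _ => le_rfl

/-- **A constant curve class is never simple** (its endpoints coincide). -/
theorem mk_const_not_mem_simple (p : ℂ) : CurveClass.mk (Curve.const p) ∉ CurveClass.simple := by
  rintro ⟨γ, hγ, h⟩
  have h0 : γ.source = (Curve.const p).source := by simpa using congrArg CurveClass.source h
  have h1 : γ.target = (Curve.const p).target := by simpa using congrArg CurveClass.target h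
  rw [Curve.source_def, Curve.source_def, Curve.const_apply] at h0
  rw [Curve.target_def, Curve.target_def, Curve.const_apply] at h1
  have : (0 : unitInterval) = 1 := hγ (h0.trans h1.symm)
  exact zero_ne_one this

/-- The weak limit at coincident endpoints approximating a point `p`: the test integrals converge
to the value at the constant class at `p`. -/
theorem weakLimitAlong_self {D : DobrushinDomain} {e : ℝ → Site 2} {s : ℕ → ℝ} {p : ℂ}
    (hs : Tendsto s atTop (𝓝[>] (0 : ℝ)))
    (he : Tendsto (fun δ => meshPoint δ (e δ)) (𝓝[>] (0 : ℝ)) (𝓝 p)) :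
    WeakLimitAlong D e e s (Measure.dirac (CurveClass.mk (Curve.const p))) := by
  intro f
  simp only [integral_law_self, integral_dirac]
  refine (f.continuous.tendsto _).comp ?_
  have h2 : Tendsto (fun n => meshPoint (s n) (e (s n))) atTop (𝓝 p) := he.comp hs
  rw [tendsto_iff_dist_tendsto_zero] at h2 ⊢
  exact squeeze_zero (fun _ => dist_nonneg) (fun n => dist_mk_const_le _ _) h2

/-- The endpoint family `δ ↦ nearestSite δ z` approximates `z`. -/
theorem tendsto_meshPoint_nearestSite (z : ℂ) :
    Tendsto (fun δ => meshPoint δ (nearestSite δ z)) (𝓝[>] (0 : ℝ)) (𝓝 z) := by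
  rw [tendsto_iff_dist_tendsto_zero]
  have h0 : Tendsto (fun δ : ℝ => δ) (𝓝[>] (0 : ℝ)) (𝓝 0) := nhdsWithin_le_nhds
  refine squeeze_zero' (Eventually.of_forall fun _ => dist_nonneg) ?_ h0
  filter_upwards [self_mem_nhdsWithin] with δ hδ
  exact dist_meshPoint_nearestSite_le hδ z

/-- A Dirac mass at a non-simple class does not satisfy the simplicity clause a.e. -/
theorem not_ae_simple_dirac_const (p : ℂ) :
    ¬ ∀ᵐ γ ∂(Measure.dirac (CurveClass.mk (Curve.const p))), γ ∈ CurveClass.simple := by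
  intro h
  rw [ae_iff] at h
  have h1 : Measure.dirac (CurveClass.mk (Curve.const p))
      {γ : CurveClass ℂ | ¬ γ ∈ CurveClass.simple} = 1 :=
    Measure.dirac_apply_of_mem (mk_const_not_mem_simple p)
  rw [h1] at h
  exact one_ne_zero h

/-- `S` with `IsEndpointApprox D a b` weakened by DROPPING the first endpoint limit
`tendsto_fst : δ · a δ → D.pt 0` (keeping `reachable` and `tendsto_snd`). -/
def CruxWithoutTendstoFst : Prop :=
  ∀ (D : DobrushinDomain) (a b : ℝ → Site 2),
    (∀ᶠ δ in 𝓝[>] (0 : ℝ), (discreteDomainGraph D.carrier δ).Reachable (a δ) (b δ)) →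
    Tendsto (fun δ => meshPoint δ (b δ)) (𝓝[>] (0 : ℝ)) (𝓝 (D.pt 1)) →
    ∀ (s : ℕ → ℝ) (ν : Measure (CurveClass ℂ)), Tendsto s atTop (𝓝[>] (0 : ℝ)) →
      IsProbabilityMeasure ν → WeakLimitAlong D a b s ν → ∀ᵐ γ ∂ν, Carrier D γ

/-- `S` with `IsEndpointApprox D a b` weakened by DROPPING the second endpoint limit
`tendsto_snd : δ · b δ → D.pt 1` (keeping `reachable` and `tendsto_fst`). -/
def CruxWithoutTendstoSnd : Prop :=
  ∀ (D : DobrushinDomain) (a b : ℝ → Site 2),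
    (∀ᶠ δ in 𝓝[>] (0 : ℝ), (discreteDomainGraph D.carrier δ).Reachable (a δ) (b δ)) →
    Tendsto (fun δ => meshPoint δ (a δ)) (𝓝[>] (0 : ℝ)) (𝓝 (D.pt 0)) →
    ∀ (s : ℕ → ℝ) (ν : Measure (CurveClass ℂ)), Tendsto s atTop (𝓝[>] (0 : ℝ)) →
      IsProbabilityMeasure ν → WeakLimitAlong D a b s ν → ∀ᵐ γ ∂ν, Carrier D γ

/-- The standard positive null sequence `s n = 1/(n+1)`. -/
theorem tendsto_one_div_succ : Tendsto (fun n : ℕ => 1 / ((n : ℝ) + 1)) atTop (𝓝[>] (0 : ℝ)) :=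
  tendsto_nhdsWithin_iff.2 ⟨tendsto_one_div_add_atTop_nhds_zero_nat,
    Eventually.of_forall fun n => mem_Ioi.2 (by positivity)⟩

/-- **Per-domain witness without `tendsto_fst`.** In EVERY Dobrushin domain the coincident
endpoints `a δ = b δ = nearestSite δ (D.pt 1)` are joined (trivially), approximate `b`, and the
SAW laws along `1/(n+1)` converge weakly to the Dirac mass at the constant curve at `b`, a
probability measure violating already the simplicity clause. -/
theorem exists_badLimit_without_tendsto_fst (D : DobrushinDomain) :
    ∃ (a b : ℝ → Site 2) (s : ℕ → ℝ) (ν : Measure (CurveClass ℂ)),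
      (∀ᶠ δ in 𝓝[>] (0 : ℝ), (discreteDomainGraph D.carrier δ).Reachable (a δ) (b δ)) ∧
      Tendsto (fun δ => meshPoint δ (b δ)) (𝓝[>] (0 : ℝ)) (𝓝 (D.pt 1)) ∧
      Tendsto s atTop (𝓝[>] (0 : ℝ)) ∧ IsProbabilityMeasure ν ∧ WeakLimitAlong D a b s ν ∧
      ¬ ∀ᵐ γ ∂ν, γ ∈ CurveClass.simple :=
  ⟨fun δ => nearestSite δ (D.pt 1), fun δ => nearestSite δ (D.pt 1), fun n => 1 / ((n : ℝ) + 1),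
    Measure.dirac (CurveClass.mk (Curve.const (D.pt 1))),
    Eventually.of_forall fun _ => SimpleGraph.Reachable.refl _, tendsto_meshPoint_nearestSite _,
    tendsto_one_div_succ, inferInstance,
    weakLimitAlong_self tendsto_one_div_succ (tendsto_meshPoint_nearestSite _),
    not_ae_simple_dirac_const _⟩

/-- **Per-domain witness without `tendsto_snd`** (symmetric: coincident endpoints at `a`). -/
theorem exists_badLimit_without_tendsto_snd (D : DobrushinDomain) :
    ∃ (a b : ℝ → Site 2) (s : ℕ → ℝ) (ν : Measure (CurveClass ℂ)),
      (∀ᶠ δ in 𝓝[>] (0 : ℝ), (discreteDomainGraph D.carrier δ).Reachable (a δ) (b δ)) ∧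
      Tendsto (fun δ => meshPoint δ (a δ)) (𝓝[>] (0 : ℝ)) (𝓝 (D.pt 0)) ∧
      Tendsto s atTop (𝓝[>] (0 : ℝ)) ∧ IsProbabilityMeasure ν ∧ WeakLimitAlong D a b s ν ∧
      ¬ ∀ᵐ γ ∂ν, γ ∈ CurveClass.simple :=
  ⟨fun δ => nearestSite δ (D.pt 0), fun δ => nearestSite δ (D.pt 0), fun n => 1 / ((n : ℝ) + 1),
    Measure.dirac (CurveClass.mk (Curve.const (D.pt 0))),
    Eventually.of_forall fun _ => SimpleGraph.Reachable.refl _, tendsto_meshPoint_nearestSite _,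
    tendsto_one_div_succ, inferInstance,
    weakLimitAlong_self tendsto_one_div_succ (tendsto_meshPoint_nearestSite _),
    not_ae_simple_dirac_const _⟩

/-- **`tendsto_fst` is load-bearing**: `S` without it is FALSE (witness in the unit disc, or any
domain: `exists_badLimit_without_tendsto_fst`). -/
theorem simpleSubseqLimits_false_without_tendsto_fst : ¬ CruxWithoutTendstoFst := by
  intro h
  obtain ⟨a, b, s, ν, hr, hb, hs, hν, hw, hbad⟩ :=
    exists_badLimit_without_tendsto_fst DobrushinDomain.unitDisc
  exact hbad ((h _ a b hr hb s ν hs hν hw).mono fun γ hγ => hγ.1)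

/-- **`tendsto_snd` is load-bearing**: `S` without it is FALSE. -/
theorem simpleSubseqLimits_false_without_tendsto_snd : ¬ CruxWithoutTendstoSnd := by
  intro h
  obtain ⟨a, b, s, ν, hr, ha, hs, hν, hw, hbad⟩ :=
    exists_badLimit_without_tendsto_snd DobrushinDomain.unitDisc
  exact hbad ((h _ a b hr ha s ν hs hν hw).mono fun γ hγ => hγ.1)

/-- `S` with the hypothesis `IsEndpointApprox D a b` dropped altogether. -/
def CruxWithoutEndpointApprox : Prop :=
  ∀ (D : DobrushinDomain) (a b : ℝ → Site 2) (s : ℕ → ℝ) (ν : Measure (CurveClass ℂ)),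
    Tendsto s atTop (𝓝[>] (0 : ℝ)) → IsProbabilityMeasure ν → WeakLimitAlong D a b s ν →
      ∀ᵐ γ ∂ν, Carrier D γ

/-- A fortiori, `S` without `IsEndpointApprox` is FALSE. -/
theorem simpleSubseqLimits_false_without_endpointApprox : ¬ CruxWithoutEndpointApprox := fun h =>
  simpleSubseqLimits_false_without_tendsto_fst fun D a b _ _ s ν hs hν hw => h D a b s ν hs hν hw

end LoadBearing

/-! ## §3 Why it resists: a disproof constructs a scaling limit, and kills the conjunct -/

section Resists

/-- The three sibling routes state the crux with the SAME body (shared item): every result of this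
file transfers verbatim. -/
theorem crux_eq_steinDefect :
    Crux = Summit.CriticalPhenomena.SAWScalingLimit.Theses.SAWSteinDefect.SimpleSubseqLimits := rfl

theorem crux_eq_tensorRG :
    Crux = Summit.CriticalPhenomena.SAWScalingLimit.Theses.SAWTensorRG.SimpleSubseqLimits := rfl

theorem crux_eq_frontierHomotopy :
    Crux = Summit.CriticalPhenomena.SAWScalingLimit.Theses.SAWFrontierHomotopy.SimpleSubseqLimits :=
  rfl

/-- **Any disproof of `S` exhibits a subsequential scaling limit of the critical SAW** (for some
Dobrushin domain and honest endpoint approximation): the hypotheses of `S` are exactly "ν is a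
weak subsequential limit", so `¬ S` is an EXISTENCE statement. No subsequential limit of critical
`ℤ²` SAW has ever been constructed (tightness at `x_c` — item stmt-CriticalPhenomena-1372 — is
open; sub-ballisticity is all that is in print), which is the first reason the crux resists. -/
theorem exists_subseqLimit_of_not (h : ¬ Crux) :
    ∃ (D : DobrushinDomain) (a b : ℝ → Site 2) (s : ℕ → ℝ) (ν : Measure (CurveClass ℂ)),
      IsEndpointApprox D a b ∧ Tendsto s atTop (𝓝[>] (0 : ℝ)) ∧ IsProbabilityMeasure ν ∧
      WeakLimitAlong D a b s ν ∧ ¬ ∀ᵐ γ ∂ν, Carrier D γ := by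
  by_contra hcon
  refine h fun D a b hab s ν hs hν hw => ?_
  by_contra hbad
  exact hcon ⟨D, a, b, s, ν, hab, hs, hν, hw, hbad⟩

/-- Conversely, where NO subsequential limit exists the crux holds vacuously: `S` restricted to a
triple `(D, a, b)` whose SAW laws have no weakly convergent subsequence is trivially true. -/
theorem cruxAt_of_no_limit {D : DobrushinDomain} {a b : ℝ → Site 2}
    (h : ∀ (s : ℕ → ℝ) (ν : Measure (CurveClass ℂ)), Tendsto s atTop (𝓝[>] (0 : ℝ)) →
      IsProbabilityMeasure ν → ¬ WeakLimitAlong D a b s ν) :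
    ∀ (s : ℕ → ℝ) (ν : Measure (CurveClass ℂ)), Tendsto s atTop (𝓝[>] (0 : ℝ)) →
      IsProbabilityMeasure ν → WeakLimitAlong D a b s ν → ∀ᵐ γ ∂ν, Carrier D γ :=
  fun s ν hs hν hw => absurd hw (h s ν hs hν)

/-- **`SLECarrier` (item stmt-CriticalPhenomena-4985) holds**: the chordal SLE_(8/3) law of a
Dobrushin domain is a probability measure carried by simple chords from `a` to `b` inside `D̄`
meeting `∂D` only at `a`, `b` — assembled from the tree's theorems `IsSLELaw.isProbabilityMeasure`
(`isProjectiveLimit_preWienerMeasure_holds`), `IsSLELaw.ae_simple` (Rohde–Schramm Thm 6.1,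
`ae_isSimpleTrace_sleTrace_of_le_four_holds`, `measurableSet_simple_holds`) and
`IsSLELaw.ae_endpoints` (Carathéodory, `mapsTo_boundaryExtension_holds`). A POSITIVE route item:
recorded here as the input of `not_sawScalingLimit_of_not`; candidate proof attached to 4985. -/
theorem sleCarrier_holds :
    Summit.CriticalPhenomena.SAWScalingLimit.Theses.SAWLoopFugacityFlow.SLECarrier := by
  intro D μ hμ
  haveI : Fact Literature.Probability.Process.isProjectiveLimit_preWienerMeasure :=
    ⟨isProjectiveLimit_preWienerMeasure_holds⟩
  refine ⟨hμ.isProbabilityMeasure, ?_⟩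
  have h4 : (8 : ℝ≥0) / 3 ≤ 4 := by
    rw [div_le_iff₀ (by norm_num : (0 : ℝ≥0) < 3)]
    norm_num
  filter_upwards [hμ.ae_simple ae_isSimpleTrace_sleTrace_of_le_four_holds
      CurveClass.measurableSet_simple_holds (by positivity) h4,
    hμ.ae_endpoints JordanDomain.mapsTo_boundaryExtension_holds] with γ h1 h2
  exact ⟨h1.1, h2.1, h2.2.1, h2.2.2, h1.2⟩

/-- A weak subsequential limit coincides with the full scaling limit when the latter exists:
if the SAW converges in law to chordal SLE_(8/3) (the summit conjunct at `(D, a, b)`), every `ν`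
as in the crux IS an SLE_(8/3) law. -/
theorem isSLELaw_of_subseqLimit {D : DobrushinDomain} {a b : ℝ → Site 2}
    (hconv : ConvergesInLawToSLE ((8 : ℝ≥0) / 3) D
      (fun δ (γ : DomainSAW D.carrier δ (a δ) (b δ)) => γ.curve)
      (fun δ => law D.carrier δ (a δ) (b δ)))
    {s : ℕ → ℝ} {ν : Measure (CurveClass ℂ)} (hs : Tendsto s atTop (𝓝[>] (0 : ℝ)))
    [IsProbabilityMeasure ν] (hw : WeakLimitAlong D a b s ν) :
    IsSLELaw ((8 : ℝ≥0) / 3) D ν := by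
  obtain ⟨Γ, hΓ, -, hT⟩ := hconv
  haveI : Fact Literature.Probability.Process.isProjectiveLimit_preWienerMeasure :=
    ⟨isProjectiveLimit_preWienerMeasure_holds⟩
  have hμ : IsSLELaw ((8 : ℝ≥0) / 3) D (Literature.Probability.Process.preWienerMeasure.map Γ) :=
    ⟨Γ, hΓ, rfl⟩
  haveI := hμ.isProbabilityMeasure
  have key : ∀ f : CurveClass ℂ →ᵇ ℝ,
      ∫ x, f x ∂ν = ∫ x, f x ∂(Literature.Probability.Process.preWienerMeasure.map Γ) := by
    intro f
    have h1 : Tendsto (fun n => ∫ γ, f γ.curve ∂(law D.carrier (s n) (a (s n)) (b (s n))))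
        atTop (𝓝 (∫ ω, f (Γ ω) ∂Literature.Probability.Process.preWienerMeasure)) :=
      (hT f).comp hs
    rw [tendsto_nhds_unique (hw f) h1,
      integral_map hΓ.aemeasurable f.continuous.aestronglyMeasurable]
  rw [ext_of_forall_integral_eq_of_IsFiniteMeasure key]
  exact hμ

/-- `S` follows from `SLECarrier` and the summit conjunct `SAWScalingLimit`. -/
theorem crux_of_sleCarrier_of_sawScalingLimit
    (hC : Summit.CriticalPhenomena.SAWScalingLimit.Theses.SAWLoopFugacityFlow.SLECarrier)
    (h : _root_.SAWScalingLimit) : Crux := by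
  intro D a b hab s ν hs hν hw
  exact (hC D ν (isSLELaw_of_subseqLimit (h D a b hab) hs hw)).2

/-- `S` follows from `SLECarrier` and the sibling support `SubseqIdentification`
(stmt-CriticalPhenomena-0783): identified limits are SLE_(8/3) laws, which are carried. -/
theorem crux_of_sleCarrier_of_subseqIdentification
    (hC : Summit.CriticalPhenomena.SAWScalingLimit.Theses.SAWLoopFugacityFlow.SLECarrier)
    (h : Summit.CriticalPhenomena.SAWScalingLimit.Theses.SAWLoopFugacityFlow.SubseqIdentification) :
    Crux := by
  intro D a b hab s ν hs hν hw
  exact (hC D ν (h D a b hab s ν hs hν hw)).2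

/-- **Refuting the crux refutes the summit conjunct.** `¬ S → ¬ SAWScalingLimit`,
unconditionally (`SLECarrier` being proved above): a non-simple, or boundary-touching,
subsequential limit of critical SAW along ANY honest endpoint approximation contradicts
Lawler–Schramm–Werner's Prediction 1 as typed in `Summits/CriticalPhenomena/Statement.lean`.
This is the second reason the crux resists: it is a NECESSARY condition for the summit. -/
theorem not_sawScalingLimit_of_not (h : ¬ Crux) : ¬ _root_.SAWScalingLimit := fun hS =>
  h (crux_of_sleCarrier_of_sawScalingLimit sleCarrier_holds hS)

/-- `¬ S → ¬ SubseqIdentification` (the hub-wide hinge stmt-CriticalPhenomena-0783 dies with the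
crux). -/
theorem not_subseqIdentification_of_not (h : ¬ Crux) :
    ¬ Summit.CriticalPhenomena.SAWScalingLimit.Theses.SAWLoopFugacityFlow.SubseqIdentification :=
  fun hI => h (crux_of_sleCarrier_of_subseqIdentification sleCarrier_holds hI)

end Resists

/-! ## §4 The soft road is closed: simplicity is not preserved under weak limits -/

section NotClosed

/-- The real "overshoot" profile `0 → 3 → 2`: `min (6t) (4 - 2t)` on `[0, 1]`. -/
def overshootFun (t : ℝ) : ℝ := min (6 * t) (4 - 2 * t)

theorem continuous_overshootFun : Continuous overshootFun := by
  unfold overshootFun; fun_prop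

/-- The overshoot curve `t ↦ min (6t) (4 - 2t) ∈ ℝ ⊆ ℂ`: runs `0 → 3 → 2` along the real axis;
distinct endpoints `0 ≠ 2`, range the segment `[0, 3]`, but NOT flat (it passes `5/2` twice with
`3` in between), hence its class is not simple. -/
def overshoot : Curve ℂ :=
  ⟨⟨fun t => ((overshootFun t : ℝ) : ℂ), by
    have := continuous_overshootFun; fun_prop⟩⟩

@[simp] theorem overshoot_apply (t : unitInterval) : overshoot t = ((overshootFun t : ℝ) : ℂ) := rfl

/-- The sheared overshoot curves `t ↦ overshoot t + i t/(n+1)`: INJECTIVE (the imaginary part is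
strictly increasing in `t`) and uniformly `1/(n+1)`-close to `overshoot`. -/
def shear (n : ℕ) : Curve ℂ :=
  ⟨⟨fun t => ((overshootFun t : ℝ) : ℂ) + Complex.I * (((t : ℝ) / ((n : ℝ) + 1) : ℝ) : ℂ), by
    have := continuous_overshootFun; fun_prop⟩⟩

@[simp] theorem shear_apply (n : ℕ) (t : unitInterval) :
    shear n t = ((overshootFun t : ℝ) : ℂ) + Complex.I * (((t : ℝ) / ((n : ℝ) + 1) : ℝ) : ℂ) := rfl

theorem shear_im (n : ℕ) (t : unitInterval) : (shear n t).im = (t : ℝ) / ((n : ℝ) + 1) := by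
  simp only [shear_apply, Complex.add_im, Complex.ofReal_im, Complex.mul_im, Complex.I_re,
    Complex.I_im, Complex.ofReal_re]
  ring

/-- The sheared curves are simple. -/
theorem shear_injective (n : ℕ) : (shear n).IsSimple := by
  intro t t' h
  have him := congrArg Complex.im h
  rw [shear_im, shear_im] at him
  have hn : (0 : ℝ) < (n : ℝ) + 1 := by positivity
  exact Subtype.ext ((div_left_inj' hn.ne').1 him)

/-- The sheared curves converge uniformly (hence in the reparametrisation distance) to the
overshoot curve. -/
theorem dist_shear_overshoot_le (n : ℕ) : dist (shear n) overshoot ≤ 1 / ((n : ℝ) + 1) := by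
  refine (Curve.dist_le_dist_toContinuousMap _ _).trans ?_
  refine (ContinuousMap.dist_le (by positivity)).2 fun t => ?_
  change dist (shear n t) (overshoot t) ≤ _
  rw [shear_apply, overshoot_apply, Complex.dist_eq, add_sub_cancel_left, norm_mul,
    Complex.norm_I, one_mul, Complex.norm_real, Real.norm_eq_abs,
    abs_of_nonneg (by have := t.2.1; positivity)]
  exact div_le_div_of_nonneg_right t.2.2 (by positivity)

theorem tendsto_mk_shear :
    Tendsto (fun n => CurveClass.mk (shear n)) atTop (𝓝 (CurveClass.mk overshoot)) := by
  rw [tendsto_iff_dist_tendsto_zero]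
  refine squeeze_zero (fun _ => dist_nonneg) (fun n => ?_) tendsto_one_div_add_atTop_nhds_zero_nat
  rw [CurveClass.dist_mk_mk]
  exact dist_shear_overshoot_le n

/-- The overshoot curve is not flat: `γ(5/12) = γ(3/4) = 5/2` but `γ(1/2) = 3`. -/
theorem overshoot_not_isFlat : ¬ overshoot.IsFlat := by
  intro h
  have hs : ((5 : ℝ) / 12) ∈ unitInterval := ⟨by norm_num, by norm_num⟩
  have hu : ((1 : ℝ) / 2) ∈ unitInterval := ⟨by norm_num, by norm_num⟩
  have ht : ((3 : ℝ) / 4) ∈ unitInterval := ⟨by norm_num, by norm_num⟩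
  have key := h ⟨_, hs⟩ ⟨_, hu⟩ ⟨_, ht⟩ (Subtype.mk_le_mk.2 (by norm_num))
    (Subtype.mk_le_mk.2 (by norm_num))
  simp only [overshoot_apply, overshootFun, Complex.ofReal_inj] at key
  norm_num at key

/-- A class in `simple` has only FLAT representatives (from the tree's description
`CurveClass.simple_eq_iInter` by injectivity moduli). -/
theorem isFlat_of_mk_mem_simple {γ : Curve ℂ} (h : CurveClass.mk γ ∈ CurveClass.simple) :
    γ.IsFlat := by
  rw [CurveClass.simple_eq_iInter] at h
  obtain ⟨-, h⟩ := h
  simp only [mem_iInter, mem_iUnion] at h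
  refine Curve.isFlat_of_forall_mem_modulusSet fun ε hε => ?_
  obtain ⟨n, hn⟩ := exists_nat_one_div_lt hε
  obtain ⟨m, hm⟩ := h n
  exact ⟨1 / (m + 1 : ℝ), by positivity,
    Curve.modulusSet_mono hn.le le_rfl (CurveClass.mem_modulusSet_of_mk_mem hm)⟩

/-- The class of the overshoot curve is NOT simple. -/
theorem mk_overshoot_not_mem_simple : CurveClass.mk overshoot ∉ CurveClass.simple := fun h =>
  overshoot_not_isFlat (isFlat_of_mk_mem_simple h)

/-- **`CurveClass.simple` is not (sequentially) closed**: simple classes `mk (shear n)` converge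
to the non-simple class `mk overshoot`. Weak limits of laws carried by simple curves need not be
carried by simple curves — the conclusion of the crux cannot come from weak convergence and the
lattice-level self-avoidance alone; it needs a quantitative no-macroscopic-self-touching input. -/
theorem simple_not_isClosed : ¬ IsClosed (CurveClass.simple : Set (CurveClass ℂ)) := fun h =>
  mk_overshoot_not_mem_simple (h.mem_of_tendsto tendsto_mk_shear
    (Eventually.of_forall fun n => CurveClass.mk_mem_simple (shear_injective n)))

/-- **Measure form.** Probability measures carried by simple classes (Dirac masses at
`mk (shear n)`) converging weakly — on all bounded continuous test functions — to a probability
measure carried by a NON-simple class. The abstract shape of `S` ("weak limits of simple-curve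
laws are carried by simple curves") is false. -/
theorem exists_weakLimit_not_ae_simple :
    ∃ (P : ℕ → Measure (CurveClass ℂ)) (ν : Measure (CurveClass ℂ)),
      (∀ n, IsProbabilityMeasure (P n)) ∧ (∀ n, ∀ᵐ γ ∂P n, γ ∈ CurveClass.simple) ∧
      IsProbabilityMeasure ν ∧
      (∀ f : CurveClass ℂ →ᵇ ℝ, Tendsto (fun n => ∫ x, f x ∂P n) atTop (𝓝 (∫ x, f x ∂ν))) ∧
      ∀ᵐ γ ∂ν, γ ∉ CurveClass.simple := by
  refine ⟨fun n => Measure.dirac (CurveClass.mk (shear n)), Measure.dirac (CurveClass.mk overshoot),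
    fun n => inferInstance, fun n => ?_, inferInstance, fun f => ?_, ?_⟩
  · rw [ae_dirac_eq, eventually_pure]
    exact CurveClass.mk_mem_simple (shear_injective n)
  · simp only [integral_dirac]
    exact (f.continuous.tendsto _).comp tendsto_mk_shear
  · rw [ae_dirac_eq, eventually_pure]
    exact mk_overshoot_not_mem_simple

end NotClosed

/-! ## §5 Free clauses: endpoints and confinement hold for EVERY subsequential limit -/

section FreeClauses

variable {D : DobrushinDomain} {a b : ℝ → Site 2} {s : ℕ → ℝ} {ν : Measure (CurveClass ℂ)}

/-- **Portmanteau transfer.** If the SAW laws along `s n` converge weakly to the probability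
measure `ν` and, for all large `n`, EVERY SAW curve at mesh `s n` lies in the closed set `F`,
then `ν` is carried by `F`. (Honesty §1 + Mathlib's `FiniteMeasure.limsup_measure_closed_le`.) -/
theorem ae_mem_of_isClosed_of_weakLimit {F : Set (CurveClass ℂ)} (hF : IsClosed F)
    [IsProbabilityMeasure ν] (h : WeakLimitAlong D a b s ν)
    (hmem : ∀ᶠ n in atTop, ∀ γ : DomainSAW D.carrier (s n) (a (s n)) (b (s n)), γ.curve ∈ F) :
    ∀ᵐ γ ∂ν, γ ∈ F := by
  let μs : ℕ → FiniteMeasure (CurveClass ℂ) := fun n =>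
    ⟨(law D.carrier (s n) (a (s n)) (b (s n))).map (fun γ => γ.curve), inferInstance⟩
  let μ : FiniteMeasure (CurveClass ℂ) := ⟨ν, inferInstance⟩
  have hlim : Tendsto μs atTop (𝓝 μ) := by
    rw [FiniteMeasure.tendsto_iff_forall_integral_tendsto]
    intro f
    have hf := h f
    refine hf.congr fun n => ?_
    change _ = ∫ x, f x ∂((law D.carrier (s n) (a (s n)) (b (s n))).map (fun γ => γ.curve))
    rw [integral_map (DomainSAW.measurable_of_top _).aemeasurable f.continuous.aestronglyMeasurable]
  have hle := FiniteMeasure.limsup_measure_closed_le_of_tendsto hlim hF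
  have hev : ∀ᶠ n in atTop, ((μs n : FiniteMeasure (CurveClass ℂ)) : Measure (CurveClass ℂ)) F = 1 := by
    filter_upwards [eventually_isProbabilityMeasure_of_tendsto h, hmem] with n hn hn'
    haveI := hn.1
    change ((law D.carrier (s n) (a (s n)) (b (s n))).map (fun γ => γ.curve)) F = 1
    rw [Measure.map_apply (DomainSAW.measurable_of_top _) hF.measurableSet]
    have : (fun γ : DomainSAW D.carrier (s n) (a (s n)) (b (s n)) => γ.curve) ⁻¹' F = univ :=
      eq_univ_of_forall fun γ => hn' γ
    rw [this, measure_univ]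
  have h1 : limsup (fun n => ((μs n : FiniteMeasure (CurveClass ℂ)) : Measure (CurveClass ℂ)) F)
      atTop = 1 := by
    rw [limsup_congr hev, limsup_const]
  rw [h1] at hle
  have hνF : ν F = 1 := le_antisymm prob_le_one hle
  have hc : ν Fᶜ = 0 := (prob_compl_eq_zero_iff hF.measurableSet).2 hνF
  rw [ae_iff]
  exact hc

/-- Distinct limits force distinct endpoints along the sequence. -/
theorem eventually_ne_of_tendsto (hab : IsEndpointApprox D a b) (hs : Tendsto s atTop (𝓝[>] (0 : ℝ))) :
    ∀ᶠ n in atTop, a (s n) ≠ b (s n) := by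
  have hne : D.pt 0 ≠ D.pt 1 := fun h => absurd (D.pt_injective h) (by decide)
  obtain ⟨U, V, hU, hV, hxU, hyV, hUV⟩ := t2_separation hne
  filter_upwards [(hab.tendsto_fst.comp hs).eventually (hU.mem_nhds hxU),
    (hab.tendsto_snd.comp hs).eventually (hV.mem_nhds hyV)] with n ha hb
  intro h
  simp only [Function.comp_apply, h] at ha
  exact Set.disjoint_iff.1 hUV ⟨ha, hb⟩

/-- Every SAW curve between DISTINCT vertices of `Ω_δ` has its trace in `closure Ω`
(the darts are mesh-graph edges, whose closed segments lie in `Ω̄` by definition). -/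
theorem curve_range_subset_closure {Ω : Set ℂ} {δ : ℝ} {u v : Site 2} (huv : u ≠ v)
    (γ : DomainSAW Ω δ u v) : γ.curve.range ⊆ closure Ω := by
  simp only [DomainSAW.curve, CurveClass.range_mk]
  refine SimpleGraph.Walk.range_toCurve_subset_of_not_nil (fun hn => huv hn.eq) fun d _ => ?_
  exact (meshGraph_adj_iff.1 (discreteDomainGraph_adj_iff.1 d.adj).1).2

/-- **The three soft clauses of the crux are FREE.** For every subsequential weak limit `ν` of the
critical SAW laws along an honest endpoint approximation, `ν`-a.e. curve class starts at `a`,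
ends at `b` and has its trace in `closure D` — by continuity of `source`/`target` and closedness
of `rangeSubset (closure D)` (portmanteau), with no SAW estimate at all. What remains of `S` is
simplicity and boundary avoidance (`crux_iff_core`). -/
theorem ae_source_target_range_of_subseqLimit (hab : IsEndpointApprox D a b)
    (hs : Tendsto s atTop (𝓝[>] (0 : ℝ))) [IsProbabilityMeasure ν] (h : WeakLimitAlong D a b s ν) :
    ∀ᵐ γ ∂ν, γ.source = D.pt 0 ∧ γ.target = D.pt 1 ∧ γ.range ⊆ closure D.carrier := by
  -- source: closed balls around `a` of radius `1/(k+1)`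
  have hsrc : ∀ k : ℕ, ∀ᵐ γ ∂ν, γ ∈ {c : CurveClass ℂ | dist c.source (D.pt 0) ≤ 1 / ((k : ℝ) + 1)} := by
    intro k
    refine ae_mem_of_isClosed_of_weakLimit
      (isClosed_le (continuous_dist.comp (CurveClass.continuous_source.prodMk continuous_const))
        continuous_const) h ?_
    have hev := (hab.tendsto_fst.comp hs).eventually
      (closedBall_mem_nhds (D.pt 0) (by positivity : (0 : ℝ) < 1 / ((k : ℝ) + 1)))
    filter_upwards [hev] with n hn γ
    simp only [DomainSAW.curve, CurveClass.source_mk, Curve.source_def]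
    change dist (γ.walk.toCurve (meshPoint (s n)) 0) (D.pt 0) ≤ _
    rw [SimpleGraph.Walk.toCurve_apply_zero]
    exact hn
  have htgt : ∀ k : ℕ, ∀ᵐ γ ∂ν, γ ∈ {c : CurveClass ℂ | dist c.target (D.pt 1) ≤ 1 / ((k : ℝ) + 1)} := by
    intro k
    refine ae_mem_of_isClosed_of_weakLimit
      (isClosed_le (continuous_dist.comp (CurveClass.continuous_target.prodMk continuous_const))
        continuous_const) h ?_
    have hev := (hab.tendsto_snd.comp hs).eventually
      (closedBall_mem_nhds (D.pt 1) (by positivity : (0 : ℝ) < 1 / ((k : ℝ) + 1)))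
    filter_upwards [hev] with n hn γ
    simp only [DomainSAW.curve, CurveClass.target_mk, Curve.target_def]
    change dist (γ.walk.toCurve (meshPoint (s n)) 1) (D.pt 1) ≤ _
    rw [SimpleGraph.Walk.toCurve_apply_one]
    exact hn
  have hrange : ∀ᵐ γ ∂ν, γ ∈ CurveClass.rangeSubset (closure D.carrier) := by
    refine ae_mem_of_isClosed_of_weakLimit (CurveClass.isClosed_rangeSubset isClosed_closure) h ?_
    filter_upwards [eventually_ne_of_tendsto hab hs] with n hn γ
    exact curve_range_subset_closure hn γ
  rw [← ae_all_iff] at hsrc htgt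
  filter_upwards [hsrc, htgt, hrange] with γ h0 h1 h2
  refine ⟨?_, ?_, h2⟩
  · by_contra hne
    obtain ⟨k, hk⟩ := exists_nat_one_div_lt (dist_pos.2 hne)
    exact absurd (h0 k) (not_le.2 hk)
  · by_contra hne
    obtain ⟨k, hk⟩ := exists_nat_one_div_lt (dist_pos.2 hne)
    exact absurd (h1 k) (not_le.2 hk)

/-- The GENUINE content of the crux: simplicity and boundary avoidance of subsequential limits. -/
def CruxCore : Prop :=
  ∀ (D : DobrushinDomain) (a b : ℝ → Site 2), IsEndpointApprox D a b →
    ∀ (s : ℕ → ℝ) (ν : Measure (CurveClass ℂ)), Tendsto s atTop (𝓝[>] (0 : ℝ)) →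
      IsProbabilityMeasure ν → WeakLimitAlong D a b s ν →
        ∀ᵐ γ ∂ν, γ ∈ CurveClass.simple ∧ γ.range ∩ frontier D.carrier ⊆ {D.pt 0, D.pt 1}

/-- **`S` is equivalent to its core** (simplicity ∧ boundary avoidance): the endpoint and
confinement clauses are theorems (`ae_source_target_range_of_subseqLimit`). Provers may drop
them; a refutation must break simplicity or boundary avoidance. -/
theorem crux_iff_core : Crux ↔ CruxCore := by
  constructor
  · intro h D a b hab s ν hs hν hw
    exact (h D a b hab s ν hs hν hw).mono fun γ hγ => ⟨hγ.1, hγ.2.2.2.2⟩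
  · intro h D a b hab s ν hs hν hw
    filter_upwards [h D a b hab s ν hs hν hw, ae_source_target_range_of_subseqLimit hab hs hw]
      with γ h1 h2
    exact ⟨h1.1, h2.1, h2.2.1, h2.2.2, h1.2⟩

end FreeClauses

/-! ## §6 The field `IsEndpointApprox.reachable` is idle: `S` ⟺ `S` without it -/

section ReachableIdle

/-- `S` with `IsEndpointApprox D a b` weakened by DROPPING `reachable` (keeping the two endpoint
limits). -/
def CruxWithoutReachable : Prop :=
  ∀ (D : DobrushinDomain) (a b : ℝ → Site 2),
    Tendsto (fun δ => meshPoint δ (a δ)) (𝓝[>] (0 : ℝ)) (𝓝 (D.pt 0)) →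
    Tendsto (fun δ => meshPoint δ (b δ)) (𝓝[>] (0 : ℝ)) (𝓝 (D.pt 1)) →
    ∀ (s : ℕ → ℝ) (ν : Measure (CurveClass ℂ)), Tendsto s atTop (𝓝[>] (0 : ℝ)) →
      IsProbabilityMeasure ν → WeakLimitAlong D a b s ν → ∀ᵐ γ ∂ν, Carrier D γ

/-- Test integrals against the SAW law only depend on the endpoints (transport along equalities of
sites; the types `DomainSAW Ω δ u v` depend on them). -/
theorem integral_law_congr {Ω : Set ℂ} {δ : ℝ} {u v u' v' : Site 2} (hu : u = u') (hv : v = v')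
    (f : CurveClass ℂ →ᵇ ℝ) :
    ∫ γ, f γ.curve ∂(law Ω δ u v) = ∫ γ, f γ.curve ∂(law Ω δ u' v') := by
  subst hu hv; rfl

/-- **`reachable` is idle**: `S` is EQUIVALENT to its version without `IsEndpointApprox.reachable`.
(`←` is trivial. `→`: along the sequence the laws are honest for large `n` (§1), so the endpoints
are joined there; off the sequence, repair the approximation by an honest one
(`SAW.exists_isEndpointApprox`) wherever `a δ`, `b δ` are not joined — the repaired pair is an
`IsEndpointApprox` with the same laws along `s n` eventually, and `S` applies to it.) Hence no
`_false_without_reachable` theorem can exist, and provers never need the field. -/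
theorem crux_iff_withoutReachable : Crux ↔ CruxWithoutReachable := by
  classical
  constructor
  · intro h D a b ha hb s ν hs hν hw
    obtain ⟨a₀, b₀, h₀⟩ := exists_isEndpointApprox D
    haveI := hν
    -- the repaired approximation
    let R : ℝ → Prop := fun δ => (discreteDomainGraph D.carrier δ).Reachable (a δ) (b δ)
    let a' : ℝ → Site 2 := fun δ => if R δ then a δ else a₀ δ
    let b' : ℝ → Site 2 := fun δ => if R δ then b δ else b₀ δ
    have key : ∀ (c c₀ : ℝ → Site 2) (p : ℂ),
        Tendsto (fun δ => meshPoint δ (c δ)) (𝓝[>] (0 : ℝ)) (𝓝 p) →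
        Tendsto (fun δ => meshPoint δ (c₀ δ)) (𝓝[>] (0 : ℝ)) (𝓝 p) →
        Tendsto (fun δ => meshPoint δ (if R δ then c δ else c₀ δ)) (𝓝[>] (0 : ℝ)) (𝓝 p) := by
      intro c c₀ p hc hc₀
      have : (fun δ => meshPoint δ (if R δ then c δ else c₀ δ)) =
          fun δ => if R δ then meshPoint δ (c δ) else meshPoint δ (c₀ δ) := by
        funext δ; split_ifs <;> rfl
      rw [this]
      exact hc.if' hc₀
    have hab' : IsEndpointApprox D a' b' := by
      refine ⟨?_, key a a₀ _ ha h₀.tendsto_fst, key b b₀ _ hb h₀.tendsto_snd⟩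
      filter_upwards [h₀.reachable] with δ hδ
      by_cases hR : R δ
      · simp only [a', b', if_pos hR]; exact hR
      · simp only [a', b', if_neg hR]; exact hδ
    -- along the sequence nothing changed, eventually
    have hev : ∀ᶠ n in atTop, R (s n) :=
      (eventually_isProbabilityMeasure_of_tendsto hw).mono fun n hn => hn.2
    have hw' : WeakLimitAlong D a' b' s ν := by
      intro f
      refine (hw f).congr' ?_
      filter_upwards [hev] with n hn
      have h1 : a (s n) = a' (s n) := by simp only [a', if_pos hn]
      have h2 : b (s n) = b' (s n) := by simp only [b', if_pos hn]
      exact integral_law_congr h1 h2 f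
    exact h D a' b' hab' s ν hs hν hw'
  · intro h D a b hab s ν hs hν hw
    exact h D a b hab.tendsto_fst hab.tendsto_snd s ν hs hν hw

end ReachableIdle

/-! ## §7 The simplicity clause is load-bearing DOWNSTREAM: range data never see the clock -/

section RangeBlind

/-- The diameter of the unit disc from `1` to `-1`, traversed once: `t ↦ 1 - 2t`. -/
def diam : Curve ℂ := ⟨⟨fun t => ((1 - 2 * (t : ℝ) : ℝ) : ℂ), by fun_prop⟩⟩

@[simp] theorem diam_apply (t : unitInterval) : diam t = ((1 - 2 * (t : ℝ) : ℝ) : ℂ) := rfl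

/-- The zigzag profile `1 → -1/3 → 1/3 → -1`: `max (1 - 4t) (min (2t - 1) (3 - 4t))`. -/
def zigFun (t : ℝ) : ℝ := max (1 - 4 * t) (min (2 * t - 1) (3 - 4 * t))

theorem continuous_zigFun : Continuous zigFun := by unfold zigFun; fun_prop

/-- The same diameter traversed with a Z-fold: `1 → -1/3 → 1/3 → -1` (the middle third of the
diameter is covered three times). Same range, same endpoints as `diam`; not flat, so its class
is not simple. -/
def zig : Curve ℂ := ⟨⟨fun t => ((zigFun t : ℝ) : ℂ), by have := continuous_zigFun; fun_prop⟩⟩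

@[simp] theorem zig_apply (t : unitInterval) : zig t = ((zigFun t : ℝ) : ℂ) := rfl

theorem diam_isSimple : diam.IsSimple := by
  intro t t' h
  have := Complex.ofReal_inj.1 h
  exact Subtype.ext (by linarith)

theorem zigFun_mem_Icc (t : unitInterval) : zigFun t ∈ Icc (-1 : ℝ) 1 := by
  obtain ⟨h0, h1⟩ := t.2
  simp only [zigFun, mem_Icc, le_max_iff, max_le_iff, le_min_iff, min_le_iff]
  constructor
  · by_cases h : (t : ℝ) ≤ 1 / 2
    · left; linarith
    · right; constructor <;> linarith
  · refine ⟨by linarith, ?_⟩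
    by_cases h : (t : ℝ) ≤ 2 / 3
    · left; linarith
    · right; linarith

/-- `zig` and `diam` have the same range (the real segment `[-1, 1]`). -/
theorem range_zig_eq_range_diam : zig.range = diam.range := by
  apply Subset.antisymm
  · rintro _ ⟨t, rfl⟩
    obtain ⟨hlo, hhi⟩ := zigFun_mem_Icc t
    refine ⟨⟨(1 - zigFun t) / 2, by constructor <;> linarith⟩, ?_⟩
    simp only [diam_apply, zig_apply, Complex.ofReal_inj]
    ring
  · rintro _ ⟨t, rfl⟩
    obtain ⟨h0, h1⟩ := t.2
    -- the value `y = 1 - 2t ∈ [-1, 1]`; hit it on the first piece (`y ≥ -1/3`) or the last one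
    by_cases hy : (1 : ℝ) / 3 ≤ (t : ℝ) * 2 / 2 + 1 / 3 ∧ (2 : ℝ) / 3 ≤ t
    · -- last piece: `3 - 4u = 1 - 2t` at `u = (1 + t)/2 ∈ [2/3, 1]`... use `u = (2 + 2t)/4`
      refine ⟨⟨(1 + (t : ℝ)) / 2, by constructor <;> linarith⟩, ?_⟩
      simp only [diam_apply, zig_apply, Complex.ofReal_inj, zigFun]
      rw [max_eq_right, min_eq_right] <;>
        [ring; linarith; (rw [min_eq_right] <;> linarith)]
    · by_cases ht : (t : ℝ) ≤ 2 / 3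
      · -- first piece: `1 - 4u = 1 - 2t` at `u = t/2 ∈ [0, 1/3]`
        refine ⟨⟨(t : ℝ) / 2, by constructor <;> linarith⟩, ?_⟩
        simp only [diam_apply, zig_apply, Complex.ofReal_inj, zigFun]
        rw [max_eq_left]
        · ring
        · exact (min_le_left _ _).trans (by linarith)
      · exact absurd ⟨by linarith, by linarith⟩ hy

/-- `zig` is not flat: `zig (1/6) = zig (2/3) = 1/3` while `zig (1/3) = -1/3`. -/
theorem zig_not_isFlat : ¬ zig.IsFlat := by
  intro h
  have hs : ((1 : ℝ) / 6) ∈ unitInterval := ⟨by norm_num, by norm_num⟩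
  have hu : ((1 : ℝ) / 3) ∈ unitInterval := ⟨by norm_num, by norm_num⟩
  have ht : ((2 : ℝ) / 3) ∈ unitInterval := ⟨by norm_num, by norm_num⟩
  have key := h ⟨_, hs⟩ ⟨_, hu⟩ ⟨_, ht⟩ (Subtype.mk_le_mk.2 (by norm_num))
    (Subtype.mk_le_mk.2 (by norm_num))
  simp only [zig_apply, zigFun, Complex.ofReal_inj] at key
  norm_num at key

theorem mk_zig_not_mem_simple : CurveClass.mk zig ∉ CurveClass.simple := fun h =>
  zig_not_isFlat (isFlat_of_mk_mem_simple h)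

theorem mk_diam_mem_simple : CurveClass.mk diam ∈ CurveClass.simple :=
  CurveClass.mk_mem_simple diam_isSimple

theorem mk_diam_ne_mk_zig : CurveClass.mk diam ≠ CurveClass.mk zig := fun h =>
  mk_zig_not_mem_simple (h ▸ mk_diam_mem_simple)

/-- **RANGE DATA ARE BLIND TO SIMPLICITY.** Two curve classes with the same range, the same source
and the same target, one simple and the other not: no functional of `(range, source, target)` —
in particular no family of avoidance events `rangeSubset S` — can certify the simplicity clause of
the crux. (The cards' "decorate the arc by a Z-fold" remark, as a theorem.) -/
theorem exists_simple_and_not_simple_same_range :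
    ∃ c c' : CurveClass ℂ, c ∈ CurveClass.simple ∧ c' ∉ CurveClass.simple ∧
      c.range = c'.range ∧ c.source = c'.source ∧ c.target = c'.target := by
  refine ⟨CurveClass.mk diam, CurveClass.mk zig, mk_diam_mem_simple, mk_zig_not_mem_simple,
    ?_, ?_, ?_⟩
  · rw [CurveClass.range_mk, CurveClass.range_mk, range_zig_eq_range_diam]
  · simp only [CurveClass.source_mk, Curve.source_def, diam_apply, zig_apply, zigFun]
    norm_num
  · simp only [CurveClass.target_mk, Curve.target_def, diam_apply, zig_apply, zigFun]
    norm_num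

/-- The marked points of the unit-disc Dobrushin domain are `1` and `-1`. -/
theorem unitDisc_pt_zero : DobrushinDomain.unitDisc.pt 0 = 1 := by
  simp [MarkedDomain.pt, DobrushinDomain.unitDisc, JordanDomain.unitDisc, circleMap]

theorem unitDisc_pt_one : DobrushinDomain.unitDisc.pt 1 = -1 := by
  simp [MarkedDomain.pt, DobrushinDomain.unitDisc, JordanDomain.unitDisc, circleMap]
  rw [show (2 * (Real.pi : ℂ) * 2⁻¹ * Complex.I) = Real.pi * Complex.I by ring]
  exact Complex.exp_pi_mul_I

/-- The diameter is a chord of the unit disc: its range lies in the closed disc and meets the unit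
circle only at `±1`. -/
theorem diam_chord : diam.range ⊆ closure (Metric.ball (0 : ℂ) 1) ∧
    diam.range ∩ frontier (Metric.ball (0 : ℂ) 1) ⊆ {(1 : ℂ), -1} := by
  rw [closure_ball _ one_ne_zero, frontier_ball _ one_ne_zero]
  constructor
  · rintro _ ⟨t, rfl⟩
    obtain ⟨h0, h1⟩ := t.2
    rw [diam_apply, Metric.mem_closedBall, dist_zero_right, Complex.norm_real, Real.norm_eq_abs,
      abs_le]
    constructor <;> linarith
  · rintro _ ⟨⟨t, rfl⟩, hx⟩
    obtain ⟨h0, h1⟩ := t.2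
    rw [Metric.mem_sphere, dist_zero_right, diam_apply, Complex.norm_real, Real.norm_eq_abs] at hx
    simp only [diam_apply, mem_insert_iff, mem_singleton_iff]
    rcases (abs_eq zero_le_one).1 hx with h | h
    · left; rw [h]; simp
    · right; rw [h]; simp

/-- `AvoidanceDeterminesLaw` (shared support stmt-CriticalPhenomena-1373) with the simplicity
clause `γ ∈ CurveClass.simple` DROPPED from both carrier hypotheses (everything else verbatim). -/
def AvoidanceDeterminesLawWithoutSimple : Prop :=
  ∀ (D : DobrushinDomain) (μ ν : Measure (CurveClass ℂ)), IsProbabilityMeasure μ →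
    IsProbabilityMeasure ν →
    (∀ᵐ γ ∂μ, γ.source = D.pt 0 ∧ γ.target = D.pt 1 ∧ γ.range ⊆ closure D.carrier ∧
      γ.range ∩ frontier D.carrier ⊆ {D.pt 0, D.pt 1}) →
    (∀ᵐ γ ∂ν, γ.source = D.pt 0 ∧ γ.target = D.pt 1 ∧ γ.range ⊆ closure D.carrier ∧
      γ.range ∩ frontier D.carrier ⊆ {D.pt 0, D.pt 1}) →
    (∀ D' : DobrushinDomain, D'.carrier ⊆ D.carrier → D'.pt 0 = D.pt 0 → D'.pt 1 = D.pt 1 →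
      (∃ ε : ℝ, 0 < ε ∧ D'.carrier ∩ Metric.ball (D.pt 0) ε = D.carrier ∩ Metric.ball (D.pt 0) ε ∧
        D'.carrier ∩ Metric.ball (D.pt 1) ε = D.carrier ∩ Metric.ball (D.pt 1) ε) →
      μ (CurveClass.rangeSubset (closure D'.carrier)) =
        ν (CurveClass.rangeSubset (closure D'.carrier))) →
    μ = ν

/-- **The simplicity clause delivered by the crux is exactly what its consumer needs**:
`AvoidanceDeterminesLaw` WITHOUT `γ ∈ simple` in the carrier is FALSE — the Dirac masses at the
diameter of the unit disc traversed once (`diam`, simple) and with a Z-fold (`zig`, not simple)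
are carried by chords from `1` to `-1` in the closed disc meeting the circle only at `±1`, give
the SAME mass to every avoidance event `rangeSubset S` (equal ranges), and differ. Hence the
decomposition `SimpleSubseqLimits` + `AvoidanceDeterminesLaw` cannot be relaxed on the simplicity
side: the order of traversal is invisible to avoidance data. -/
theorem avoidanceDeterminesLaw_false_without_simple : ¬ AvoidanceDeterminesLawWithoutSimple := by
  intro h
  have hcar : ∀ c : Curve ℂ, c.range = diam.range → c 0 = 1 → c 1 = -1 →
      ∀ᵐ γ ∂(Measure.dirac (CurveClass.mk c)), γ.source = DobrushinDomain.unitDisc.pt 0 ∧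
        γ.target = DobrushinDomain.unitDisc.pt 1 ∧
        γ.range ⊆ closure DobrushinDomain.unitDisc.carrier ∧
        γ.range ∩ frontier DobrushinDomain.unitDisc.carrier ⊆
          {DobrushinDomain.unitDisc.pt 0, DobrushinDomain.unitDisc.pt 1} := by
    intro c hc h0 h1
    rw [ae_dirac_eq, eventually_pure, unitDisc_pt_zero, unitDisc_pt_one, CurveClass.source_mk,
      CurveClass.target_mk, CurveClass.range_mk, hc]
    exact ⟨h0, h1, diam_chord⟩
  have hμ := hcar diam rfl (by simp) (by simp; norm_num)
  have hν := hcar zig range_zig_eq_range_diam (by simp [zigFun]) (by simp [zigFun]; norm_num)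
  have heq := h DobrushinDomain.unitDisc (Measure.dirac (CurveClass.mk diam))
    (Measure.dirac (CurveClass.mk zig)) inferInstance inferInstance hμ hν ?_
  · have h1 : (Measure.dirac (CurveClass.mk diam)) {CurveClass.mk diam} =
        (Measure.dirac (CurveClass.mk zig)) {CurveClass.mk diam} := by rw [heq]
    rw [Measure.dirac_apply_of_mem (mem_singleton _),
      Measure.dirac_apply' _ (measurableSet_singleton _),
      indicator_of_notMem (fun h => mk_diam_ne_mk_zig (mem_singleton_iff.1 h).symm)] at h1
    exact one_ne_zero h1
  · intro D' _ _ _ _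
    have hm := CurveClass.measurableSet_rangeSubset (E := ℂ) (S := closure D'.carrier)
      isClosed_closure
    have hiff : CurveClass.mk diam ∈ CurveClass.rangeSubset (closure D'.carrier) ↔
        CurveClass.mk zig ∈ CurveClass.rangeSubset (closure D'.carrier) := by
      simp only [CurveClass.mem_rangeSubset, CurveClass.range_mk, range_zig_eq_range_diam]
    rw [Measure.dirac_apply' _ hm, Measure.dirac_apply' _ hm]
    by_cases hmem : CurveClass.mk diam ∈ CurveClass.rangeSubset (closure D'.carrier)
    · rw [indicator_of_mem hmem, indicator_of_mem (hiff.1 hmem)]; rfl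
    · rw [indicator_of_notMem hmem, indicator_of_notMem (fun h => hmem (hiff.2 h))]

end RangeBlind

/-! ## §8 Non-vacuity modulo `EventualTight`: subsequential limits exist along every sequence -/

section NonVacuity

/-- Honest laws: in a bounded domain at positive mesh, between DISTINCT joined vertices the critical
SAW law is a probability measure (finitely many SAWs, `finite_domainSAW_of_isBounded`; positive
weight `x_c ^ |γ| > 0` of one of them, `criticalFugacity_pos_lt_one'`). -/
theorem isProbabilityMeasure_law_of_reachable {Ω : Set ℂ} (hΩ : Bornology.IsBounded Ω) {δ : ℝ}
    (hδ : 0 < δ) {u v : Site 2} (huv : u ≠ v) (h : (discreteDomainGraph Ω δ).Reachable u v) :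
    IsProbabilityMeasure (law Ω δ u v) := by
  classical
  obtain ⟨p⟩ := h
  have hu : u ∈ meshDomain Ω δ := by
    cases p with
    | nil => exact absurd rfl huv
    | cons hadj _ => exact (discreteDomainGraph_adj_iff.1 hadj).2.1
  haveI := Literature.Barriers.CriticalPhenomena.SupercriticalSAW.finite_domainSAW_of_isBounded hΩ hδ
    (v := v) hu
  haveI := Fintype.ofFinite (DomainSAW Ω δ u v)
  let γ₀ : DomainSAW Ω δ u v := ⟨p.toPath.1, p.toPath.2⟩
  have huniv : weight Ω δ u v univ = ∑ γ : DomainSAW Ω δ u v,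
      ENNReal.ofReal (criticalFugacity ^ γ.length) := by
    rw [weight, Measure.sum_apply _ MeasurableSet.univ, tsum_fintype]
    simp
  have htop : weight Ω δ u v univ ≠ ∞ := by
    rw [huniv]; exact ENNReal.sum_ne_top.2 fun _ _ => ENNReal.ofReal_ne_top
  have hpos : weight Ω δ u v univ ≠ 0 := by
    rw [huniv]
    refine ne_of_gt (lt_of_lt_of_le ?_ (Finset.single_le_sum (f := fun γ : DomainSAW Ω δ u v =>
      ENNReal.ofReal (criticalFugacity ^ γ.length)) (fun _ _ => zero_le) (Finset.mem_univ γ₀)))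
    exact ENNReal.ofReal_pos.2 (pow_pos criticalFugacity_pos_lt_one'.1 _)
  refine ⟨?_⟩
  rw [law, Measure.smul_apply, smul_eq_mul, ENNReal.inv_mul_cancel hpos htop]

/-- Under an honest endpoint approximation the laws are probability measures for all small
`δ > 0` (distinct limits ⇒ distinct endpoints; `reachable`; boundedness of the Jordan domain). -/
theorem eventually_isProbabilityMeasure_law {D : DobrushinDomain} {a b : ℝ → Site 2}
    (hab : IsEndpointApprox D a b) :
    ∀ᶠ δ in 𝓝[>] (0 : ℝ), IsProbabilityMeasure (law D.carrier δ (a δ) (b δ)) := by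
  have hne : D.pt 0 ≠ D.pt 1 := fun h => absurd (D.pt_injective h) (by decide)
  obtain ⟨U, V, hU, hV, hxU, hyV, hUV⟩ := t2_separation hne
  filter_upwards [hab.reachable, hab.tendsto_fst.eventually (hU.mem_nhds hxU),
    hab.tendsto_snd.eventually (hV.mem_nhds hyV), self_mem_nhdsWithin] with δ hr ha hb hδ
  refine isProbabilityMeasure_law_of_reachable D.isBounded hδ (fun h => ?_) hr
  rw [h] at ha
  exact Set.disjoint_iff.1 hUV ⟨ha, hb⟩

/-- **Non-vacuity of the crux modulo `EventualTight` (stmt-CriticalPhenomena-1372, wanted by all four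
routes).** If the pushed-forward critical SAW laws are eventually tight, then along EVERY sequence of
meshes `s n → 0⁺` some subsequence converges weakly to a probability measure `ν` — i.e. the
hypotheses of `S` are satisfiable at every `(D, a, b)` (Prokhorov on the Polish `CurveClass ℂ`,
through the tree's `IsTightAlongMesh.exists_subseq` applied to the laws clamped to probability
measures, which changes nothing for small `δ`). So `S` is vacuous exactly where tightness fails,
and a genuine constraint in the regime the routes work in. -/
theorem exists_weakLimitAlong_of_eventualTight
    (hT : Summit.CriticalPhenomena.SAWScalingLimit.Theses.SAWLoopFugacityFlow.EventualTight)
    {D : DobrushinDomain} {a b : ℝ → Site 2} (hab : IsEndpointApprox D a b) {s : ℕ → ℝ}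
    (hs : Tendsto s atTop (𝓝[>] (0 : ℝ))) :
    ∃ (φ : ℕ → ℕ) (ν : Measure (CurveClass ℂ)), StrictMono φ ∧ IsProbabilityMeasure ν ∧
      WeakLimitAlong D a b (s ∘ φ) ν := by
  classical
  obtain ⟨δ₀, hδ₀, htight⟩ := hT D a b hab
  -- the pushed-forward laws, clamped to probability measures (no change for small `δ`)
  let Q : ℝ → Measure (CurveClass ℂ) := fun δ =>
    (law D.carrier δ (a δ) (b δ)).map (fun γ => γ.curve)
  let c₀ : CurveClass ℂ := CurveClass.mk (Curve.const 0)
  let P : ℝ → Measure (CurveClass ℂ) := fun δ =>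
    if IsProbabilityMeasure (Q δ) then Q δ else Measure.dirac c₀
  have hP : ∀ δ, IsProbabilityMeasure (P δ) := by
    intro δ
    by_cases h : IsProbabilityMeasure (Q δ)
    · simp only [P, if_pos h]; exact h
    · simp only [P, if_neg h]; infer_instance
  have hPQ : ∀ᶠ δ in 𝓝[>] (0 : ℝ), P δ = Q δ := by
    filter_upwards [eventually_isProbabilityMeasure_law hab] with δ hδ
    have : IsProbabilityMeasure (Q δ) :=
      Measure.isProbabilityMeasure_map (DomainSAW.measurable_of_top _).aemeasurable
    simp only [P, if_pos this]
  -- tightness along the mesh of the clamped family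
  have hTight : @IsTightAlongMesh (fun _ => CurveClass ℂ) _ (CurveClass ℂ) _ (fun _ => id) P := by
    intro ε hε
    obtain ⟨K, hK, hle⟩ := isTightMeasureSet_iff_exists_isCompact_measure_compl_le.1 htight ε hε
    refine ⟨K, hK, ?_⟩
    filter_upwards [hPQ, Ioc_mem_nhdsGT hδ₀] with δ hδ hmem
    rw [Set.preimage_id_eq, id, hδ]
    exact hle _ ⟨δ, hmem, rfl⟩
  haveI : ∀ δ, IsProbabilityMeasure (P δ) := hP
  obtain ⟨φ, ν, hφ, hν, hlim⟩ := IsTightAlongMesh.exists_subseq hTight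
    (Eventually.of_forall fun δ => aemeasurable_id) hs
  refine ⟨φ, ν, hφ, hν, fun f => ?_⟩
  have hev : ∀ᶠ n in atTop, P (s (φ n)) = Q (s (φ n)) :=
    (hs.comp hφ.tendsto_atTop).eventually hPQ
  refine (hlim f).congr' ?_
  filter_upwards [hev] with n hn
  simp only [id, Function.comp_apply]
  rw [hn]
  exact integral_map (DomainSAW.measurable_of_top _).aemeasurable f.continuous.aestronglyMeasurable

end NonVacuity

/-! ## §9 CRITICALITY is load-bearing: at every `x > x_c` the crux holds only vacuously -/

section Supercritical

open Literature.Barriers.CriticalPhenomena Literature.Barriers.CriticalPhenomena.SupercriticalSAW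

/-- The crux at fugacity `x`: `SAW.law` (weights `x_c^{|γ|}`) replaced by the parameter-`x` law
`lawAt x` (weights `x^{|γ|}`, Duminil-Copin–Kozma–Yadin), everything else verbatim. -/
def CruxAt (x : ℝ) : Prop :=
  ∀ (D : DobrushinDomain) (a b : ℝ → Site 2), IsEndpointApprox D a b →
    ∀ (s : ℕ → ℝ) (ν : Measure (CurveClass ℂ)), Tendsto s atTop (𝓝[>] (0 : ℝ)) →
      IsProbabilityMeasure ν →
      (∀ f : CurveClass ℂ →ᵇ ℝ,
        Tendsto (fun n => ∫ γ, f γ.curve ∂(lawAt x D.carrier (s n) (a (s n)) (b (s n)))) atTop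
          (𝓝 (∫ x, f x ∂ν))) →
      ∀ᵐ γ ∂ν, Carrier D γ

/-- At `x = x_c` this is the crux (`lawAt x_c = law` definitionally). -/
theorem cruxAt_criticalFugacity : CruxAt criticalFugacity ↔ Crux := Iff.rfl

/-- The parameter-`x` law has total mass `≤ 1` on every event (normalised weight, junk `0`). -/
theorem lawAt_apply_le_one (x : ℝ) (Ω : Set ℂ) (δ : ℝ) (a b : Site 2)
    (S : Set (DomainSAW Ω δ a b)) : lawAt x Ω δ a b S ≤ 1 := by
  rw [lawAt, Measure.smul_apply, smul_eq_mul]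
  exact (mul_le_mul' le_rfl (measure_mono (μ := weightAt x Ω δ a b) (subset_univ S))).trans
    (ENNReal.inv_mul_le_one _)

instance isFiniteMeasure_lawAt (x : ℝ) (Ω : Set ℂ) (δ : ℝ) (a b : Site 2) :
    IsFiniteMeasure (lawAt x Ω δ a b) :=
  ⟨(lawAt_apply_le_one x Ω δ a b univ).trans_lt ENNReal.one_lt_top⟩

/-- Reindexing a sequence of meshes as a mesh family: `δ ↦ ⌊δ⁻¹⌋₊ → ∞` as `δ → 0⁺`. -/
theorem tendsto_floor_inv_atTop : Tendsto (fun δ : ℝ => ⌊δ⁻¹⌋₊) (𝓝[>] (0 : ℝ)) atTop :=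
  tendsto_nat_floor_atTop.comp tendsto_inv_nhdsGT_zero

/-- **Supercritical subsequential limits are ONTO the disc.** For `x > x_c`, in the unit disc
`(𝔻; 1, -1)` with closest-site endpoints (Duminil-Copin–Kozma–Yadin's setting; Theorem 1 is
PROVED in the tree, `DKY2014_thm1_holds`), every probability measure `ν` that is the weak limit of
the parameter-`x` SAW laws along some `s n → 0⁺` is carried by curves whose trace CONTAINS the
open disc (the tree's portmanteau mechanism `ae_subset_range_of_tendstoLaw`, run on the sequence
reindexed as a mesh family). -/
theorem ae_unitDisk_subset_range_of_supercritical_weakLimit {x : ℝ} (hx : criticalFugacity < x)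
    {A B : ℝ → Site 2}
    (hAB : ∀ δ : ℝ, 0 < δ → IsClosestSite unitDisk δ 1 (A δ) ∧ IsClosestSite unitDisk δ (-1) (B δ))
    {s : ℕ → ℝ} (hs : Tendsto s atTop (𝓝[>] (0 : ℝ))) {ν : Measure (CurveClass ℂ)}
    [IsProbabilityMeasure ν]
    (hw : ∀ f : CurveClass ℂ →ᵇ ℝ,
      Tendsto (fun n => ∫ γ, f γ.curve ∂(lawAt x unitDisk (s n) (A (s n)) (B (s n)))) atTop
        (𝓝 (∫ x, f x ∂ν))) :
    ∀ᵐ γ ∂ν, unitDisk ⊆ γ.range := by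
  have hne : (1 : ℂ) ≠ -1 := fun h => by
    have h' := congrArg Complex.re h
    norm_num at h'
  have hfill : IsSpaceFillingLaws DobrushinDomain.unitDisc.carrier A B
      (fun δ => lawAt x DobrushinDomain.unitDisc.carrier δ (A δ) (B δ)) :=
    isSpaceFillingLaws_lawAt_iff.2
      (isSpaceFillingFamily_of_DKY2014_thm1 DKY2014_thm1_holds (by simp) (by simp) hne hAB hx)
  -- the sequence as a mesh family
  let N : ℝ → ℕ := fun δ => ⌊δ⁻¹⌋₊
  let m : ℝ → ℝ := fun δ => s (N δ)
  have hm : Tendsto m (𝓝[>] (0 : ℝ)) (𝓝[>] (0 : ℝ)) := hs.comp tendsto_floor_inv_atTop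
  let X : ∀ δ : ℝ, DomainSAW unitDisk (m δ) (A (m δ)) (B (m δ)) → CurveClass ℂ :=
    fun δ γ => γ.curve
  let P : ∀ δ : ℝ, Measure (DomainSAW unitDisk (m δ) (A (m δ)) (B (m δ))) :=
    fun δ => lawAt x unitDisk (m δ) (A (m δ)) (B (m δ))
  have hT : TendstoLaw X P id ν := fun f => (hw f).comp tendsto_floor_inv_atTop
  refine ae_subset_range_of_tendstoLaw (X := X) (P := P) (Γ := id) (W := ν)
    (fun _ => DomainSAW.measurable_of_top _) aemeasurable_id hT Metric.isOpen_ball ?_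
  intro z r hr hball
  exact (hfill.tendsto_measure_disjoint_ball hr hball).comp hm

/-- Hence **no supercritical subsequential limit is carried by simple curves** (a simple curve
covers no open set, `not_subset_range_of_mem_simple`). -/
theorem not_ae_simple_of_supercritical_weakLimit {x : ℝ} (hx : criticalFugacity < x)
    {A B : ℝ → Site 2}
    (hAB : ∀ δ : ℝ, 0 < δ → IsClosestSite unitDisk δ 1 (A δ) ∧ IsClosestSite unitDisk δ (-1) (B δ))
    {s : ℕ → ℝ} (hs : Tendsto s atTop (𝓝[>] (0 : ℝ))) {ν : Measure (CurveClass ℂ)}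
    [IsProbabilityMeasure ν]
    (hw : ∀ f : CurveClass ℂ →ᵇ ℝ,
      Tendsto (fun n => ∫ γ, f γ.curve ∂(lawAt x unitDisk (s n) (A (s n)) (B (s n)))) atTop
        (𝓝 (∫ x, f x ∂ν))) :
    ¬ ∀ᵐ γ ∂ν, γ ∈ CurveClass.simple := by
  intro hsimple
  have h := ae_unitDisk_subset_range_of_supercritical_weakLimit hx hAB hs hw
  have hfalse : ∀ᵐ γ ∂ν, False := by
    filter_upwards [hsimple, h] with γ h1 h2
    exact not_subset_range_of_mem_simple h1 Metric.isOpen_ball ⟨0, Metric.mem_ball_self one_pos⟩ h2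
  rw [eventually_false_iff_eq_bot, ae_eq_bot] at hfalse
  exact IsProbabilityMeasure.ne_zero ν hfalse

/-- **CRITICALITY IS LOAD-BEARING (modulo existence of limits).** For every `x > x_c`: if the
parameter-`x` SAW in `(𝔻; 1, -1)` with closest-site endpoints has ANY subsequential weak limit
(e.g. if its laws are tight — expected, the conjectural limit being SLE₈), then the crux at
fugacity `x` is FALSE. The same statement with `x_c` replaced by any larger fugacity cannot be
proved by an argument insensitive to the value of `x`. -/
theorem cruxAt_false_of_supercritical_limit {x : ℝ} (hx : criticalFugacity < x)
    (h : ∃ (A B : ℝ → Site 2) (s : ℕ → ℝ) (ν : Measure (CurveClass ℂ)),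
      (∀ δ : ℝ, 0 < δ → IsClosestSite unitDisk δ 1 (A δ) ∧ IsClosestSite unitDisk δ (-1) (B δ)) ∧
      Tendsto s atTop (𝓝[>] (0 : ℝ)) ∧ IsProbabilityMeasure ν ∧
      ∀ f : CurveClass ℂ →ᵇ ℝ,
        Tendsto (fun n => ∫ γ, f γ.curve ∂(lawAt x unitDisk (s n) (A (s n)) (B (s n)))) atTop
          (𝓝 (∫ x, f x ∂ν))) :
    ¬ CruxAt x := by
  obtain ⟨A, B, s, ν, hAB, hs, hν, hw⟩ := h
  intro hC
  have := hC DobrushinDomain.unitDisc A B (isEndpointApprox_unitDisc_of_isClosestSite hAB) s ν hs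
    hν hw
  exact not_ae_simple_of_supercritical_weakLimit hx hAB hs hw (this.mono fun γ hγ => hγ.1)

/-- Unconditional reading: **at `x > x_c` the crux can only hold VACUOUSLY** — `CruxAt x` implies
that the supercritical SAW of `(𝔻; 1, -1)` (closest sites) has no subsequential weak limit along
any sequence of meshes. -/
theorem no_supercritical_limit_of_cruxAt {x : ℝ} (hx : criticalFugacity < x) (hC : CruxAt x)
    {A B : ℝ → Site 2}
    (hAB : ∀ δ : ℝ, 0 < δ → IsClosestSite unitDisk δ 1 (A δ) ∧ IsClosestSite unitDisk δ (-1) (B δ))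
    {s : ℕ → ℝ} (hs : Tendsto s atTop (𝓝[>] (0 : ℝ))) {ν : Measure (CurveClass ℂ)}
    [hν : IsProbabilityMeasure ν] :
    ¬ ∀ f : CurveClass ℂ →ᵇ ℝ,
      Tendsto (fun n => ∫ γ, f γ.curve ∂(lawAt x unitDisk (s n) (A (s n)) (B (s n)))) atTop
        (𝓝 (∫ x, f x ∂ν)) := fun hw =>
  cruxAt_false_of_supercritical_limit hx ⟨A, B, s, ν, hAB, hs, hν, hw⟩ hC

end Supercritical

/-! ## §10 No finite-mesh version: the endpoint clause fails at EVERY positive mesh -/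

section FiniteMesh

/-- At a fixed mesh, a SAW between distinct joined vertices starts at an INTERIOR mesh point,
never at the boundary point `a = D.pt 0`: the carrier clause of the crux is a limit phenomenon and
has no finite-`δ` analogue (so `S` cannot be obtained by closedness from a property of the
approximants — compare §4/§5: the endpoint clauses pass to the limit only through CONVERGENCE of
the mesh points, the simplicity clause not at all). -/
theorem curve_source_ne_pt {D : DobrushinDomain} {δ : ℝ} {u v : Site 2} (huv : u ≠ v)
    (γ : DomainSAW D.carrier δ u v) : γ.curve.source ≠ D.pt 0 := by
  have hu : u ∈ meshDomain D.carrier δ := by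
    cases hγ : γ.walk with
    | nil => exact absurd rfl huv
    | cons hadj _ => exact (discreteDomainGraph_adj_iff.1 hadj).2.1
  have hin : meshPoint δ u ∈ D.carrier := meshDomain_subset_meshVertices _ _ hu
  have hsrc : γ.curve.source = meshPoint δ u := by
    simp only [DomainSAW.curve, CurveClass.source_mk, Curve.source_def]
    exact SimpleGraph.Walk.toCurve_apply_zero _ _
  rw [hsrc]
  intro h
  have hfr := D.pt_mem_frontier 0
  rw [← h, frontier, D.isOpen.interior_eq] at hfr
  exact hfr.2 hin

/-- Hence along an honest approximation, for all large `n`, NO approximant satisfies the crux's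
carrier clause (the pushed-forward laws are carried by its complement), although every weak limit
is claimed to be carried by it. -/
theorem eventually_forall_not_carrier {D : DobrushinDomain} {a b : ℝ → Site 2}
    (hab : IsEndpointApprox D a b) {s : ℕ → ℝ} (hs : Tendsto s atTop (𝓝[>] (0 : ℝ))) :
    ∀ᶠ n in atTop, ∀ γ : DomainSAW D.carrier (s n) (a (s n)) (b (s n)), ¬ Carrier D γ.curve := by
  filter_upwards [eventually_ne_of_tendsto hab hs] with n hn γ hC
  exact curve_source_ne_pt hn γ hC.2.1

end FiniteMesh


/-! ## §11 `IsProbabilityMeasure ν` is idle — but JOINTLY load-bearing with `reachable` (gen 2) -/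

section ProbabilityIdle

/-- Distinct limits force distinct endpoints for all small `δ > 0` (the `𝓝[>] 0` form of
`eventually_ne_of_tendsto`). -/
theorem eventually_ne_nhdsGT {D : DobrushinDomain} {a b : ℝ → Site 2} (hab : IsEndpointApprox D a b) :
    ∀ᶠ δ in 𝓝[>] (0 : ℝ), a δ ≠ b δ := by
  have hne : D.pt 0 ≠ D.pt 1 := fun h => absurd (D.pt_injective h) (by decide)
  obtain ⟨U, V, hU, hV, hxU, hyV, hUV⟩ := t2_separation hne
  filter_upwards [hab.tendsto_fst.eventually (hU.mem_nhds hxU),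
    hab.tendsto_snd.eventually (hV.mem_nhds hyV)] with δ ha hb h
  rw [h] at ha
  exact Set.disjoint_iff.1 hUV ⟨ha, hb⟩

/-- `S` with the hypothesis `IsProbabilityMeasure ν` DROPPED (`ν` an arbitrary measure). -/
def CruxWithoutIsProbability : Prop :=
  ∀ (D : DobrushinDomain) (a b : ℝ → Site 2), IsEndpointApprox D a b →
    ∀ (s : ℕ → ℝ) (ν : Measure (CurveClass ℂ)), Tendsto s atTop (𝓝[>] (0 : ℝ)) →
      WeakLimitAlong D a b s ν → ∀ᵐ γ ∂ν, Carrier D γ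

/-- **The weak-limit hypothesis forces `ν` to be a probability measure** (given `IsEndpointApprox` and
`s n → 0⁺`): test the constant function `1` — the laws have total mass `1` for large `n` (§8), and
`∫ 1 dν = ν.real univ` for EVERY measure (`0` when `ν` is infinite), so `ν univ = 1`. -/
theorem isProbabilityMeasure_of_weakLimitAlong {D : DobrushinDomain} {a b : ℝ → Site 2}
    (hab : IsEndpointApprox D a b) {s : ℕ → ℝ} (hs : Tendsto s atTop (𝓝[>] (0 : ℝ)))
    {ν : Measure (CurveClass ℂ)} (hw : WeakLimitAlong D a b s ν) : IsProbabilityMeasure ν := by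
  have h1 := hw 1
  have hev : ∀ᶠ n in atTop, ∫ γ, (1 : CurveClass ℂ →ᵇ ℝ) γ.curve
      ∂(law D.carrier (s n) (a (s n)) (b (s n))) = 1 := by
    filter_upwards [hs.eventually (eventually_isProbabilityMeasure_law hab)] with n hn
    haveI := hn
    simp
  have hlim : (1 : ℝ) = ∫ x, (1 : CurveClass ℂ →ᵇ ℝ) x ∂ν :=
    tendsto_nhds_unique (tendsto_const_nhds.congr' (hev.mono fun n hn => hn.symm)) h1
  have hreal : ν.real univ = 1 := by
    have : ∫ x, (1 : CurveClass ℂ →ᵇ ℝ) x ∂ν = ν.real univ := by simp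
    rw [← this, ← hlim]
  exact ⟨(ENNReal.toReal_eq_one_iff _).1 hreal⟩

/-- **`IsProbabilityMeasure ν` is idle**: `S` ⟺ `S` without it (no `_false_without_isProbability`
theorem can exist; provers get the instance for free). -/
theorem crux_iff_withoutIsProbability : Crux ↔ CruxWithoutIsProbability := by
  constructor
  · intro h D a b hab s ν hs hw
    haveI := isProbabilityMeasure_of_weakLimitAlong hab hs hw
    exact h D a b hab s ν hs inferInstance hw
  · intro h D a b hab s ν hs _ hw
    exact h D a b hab s ν hs hw

/-- `S` with BOTH `IsProbabilityMeasure ν` and `IsEndpointApprox.reachable` dropped (keeping the two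
endpoint limits, `s n → 0⁺` and the weak convergence). -/
def CruxWithoutIsProbabilityAndReachable : Prop :=
  ∀ (D : DobrushinDomain) (a b : ℝ → Site 2),
    Tendsto (fun δ => meshPoint δ (a δ)) (𝓝[>] (0 : ℝ)) (𝓝 (D.pt 0)) →
    Tendsto (fun δ => meshPoint δ (b δ)) (𝓝[>] (0 : ℝ)) (𝓝 (D.pt 1)) →
    ∀ (s : ℕ → ℝ) (ν : Measure (CurveClass ℂ)), Tendsto s atTop (𝓝[>] (0 : ℝ)) →
      WeakLimitAlong D a b s ν → ∀ᵐ γ ∂ν, Carrier D γ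

/-- No SAW reaches a site outside the discrete domain. -/
theorem isEmpty_domainSAW_of_not_mem {Ω : Set ℂ} {δ : ℝ} {u v : Site 2} (huv : u ≠ v)
    (hv : v ∉ meshDomain Ω δ) : IsEmpty (DomainSAW Ω δ u v) := by
  refine ⟨fun γ => ?_⟩
  cases hγ : γ.walk.reverse with
  | nil => exact huv rfl
  | cons hadj _ => exact hv (discreteDomainGraph_adj_iff.1 hadj).2.1

/-- Towards an unreachable endpoint the law is the zero measure. -/
theorem law_eq_zero_of_not_mem {Ω : Set ℂ} {δ : ℝ} {u v : Site 2} (huv : u ≠ v)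
    (hv : v ∉ meshDomain Ω δ) : law Ω δ u v = 0 := by
  haveI := isEmpty_domainSAW_of_not_mem huv hv
  exact Measure.eq_zero_of_isEmpty _

/-- The endpoint family `b δ := nearestSite δ (-1 - 3δ)`: its mesh point is within `δ` of `-1 - 3δ`,
hence OUTSIDE the closed unit disc for `δ > 0`. -/
theorem norm_meshPoint_outside {δ : ℝ} (hδ : 0 < δ) :
    1 + 2 * δ ≤ ‖meshPoint δ (nearestSite δ (-1 - 3 * δ))‖ := by
  have h1 := dist_meshPoint_nearestSite_le hδ (-1 - 3 * δ : ℂ)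
  rw [dist_eq_norm] at h1
  have h2 : ‖(-1 - 3 * δ : ℂ)‖ = 1 + 3 * δ := by
    have : (-1 - 3 * δ : ℂ) = ((-(1 + 3 * δ) : ℝ) : ℂ) := by push_cast; ring
    rw [this, Complex.norm_real, Real.norm_eq_abs, abs_neg, abs_of_pos (by linarith)]
  have h3 := norm_sub_norm_le (-1 - 3 * δ : ℂ) (meshPoint δ (nearestSite δ (-1 - 3 * δ)))
  rw [← norm_neg, neg_sub] at h1
  linarith

/-- … yet it converges to `-1 = unitDisc.pt 1`. -/
theorem tendsto_meshPoint_outside :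
    Tendsto (fun δ : ℝ => meshPoint δ (nearestSite δ (-1 - 3 * δ))) (𝓝[>] (0 : ℝ)) (𝓝 (-1)) := by
  rw [tendsto_iff_dist_tendsto_zero]
  have h0 : Tendsto (fun δ : ℝ => 4 * δ) (𝓝[>] (0 : ℝ)) (𝓝 0) := by
    have : Tendsto (fun δ : ℝ => 4 * δ) (𝓝 (0 : ℝ)) (𝓝 (4 * 0)) :=
      tendsto_const_nhds.mul tendsto_id
    rw [mul_zero] at this
    exact this.mono_left nhdsWithin_le_nhds
  refine squeeze_zero' (Eventually.of_forall fun _ => dist_nonneg) ?_ h0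
  filter_upwards [self_mem_nhdsWithin] with δ hδ
  have hδ' : (0 : ℝ) < δ := hδ
  calc dist (meshPoint δ (nearestSite δ (-1 - 3 * δ))) (-1)
      ≤ dist (meshPoint δ (nearestSite δ (-1 - 3 * δ))) (-1 - 3 * δ) + dist (-1 - 3 * δ : ℂ) (-1) :=
        dist_triangle _ _ _
    _ ≤ δ + 3 * δ := by
        refine add_le_add (dist_meshPoint_nearestSite_le hδ' _) ?_
        rw [dist_eq_norm]
        have : (-1 - 3 * δ : ℂ) - (-1) = ((-(3 * δ) : ℝ) : ℂ) := by push_cast; ring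
        rw [this, Complex.norm_real, Real.norm_eq_abs, abs_neg, abs_of_pos (by linarith)]
    _ = 4 * δ := by ring

/-- **`IsProbabilityMeasure ν` and `reachable` are JOINTLY load-bearing**: dropping both makes `S`
FALSE. Witness in the unit disc: `a δ = nearestSite δ 1`, `b δ = nearestSite δ (-1 - 3δ)` (mesh point
outside the disc ⇒ `b δ ∉ Ω_δ` ⇒ every law is `0`), `ν = ∞ • δ_{constant curve at 0}`: all test
integrals vanish on both sides (Lean's `∫ f ∂(∞ • μ) = 0`), yet `ν`-a.e. means `δ`-a.e. and the
constant class is not simple. (Each of the two hypotheses alone is idle: §6 and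
`crux_iff_withoutIsProbability`.) -/
theorem crux_false_without_isProbability_and_reachable :
    ¬ CruxWithoutIsProbabilityAndReachable := by
  intro h
  set D := DobrushinDomain.unitDisc with hD
  let a : ℝ → Site 2 := fun δ => nearestSite δ 1
  let b : ℝ → Site 2 := fun δ => nearestSite δ (-1 - 3 * δ)
  let c₀ : CurveClass ℂ := CurveClass.mk (Curve.const 0)
  let ν : Measure (CurveClass ℂ) := (∞ : ℝ≥0∞) • Measure.dirac c₀
  have ha : Tendsto (fun δ => meshPoint δ (a δ)) (𝓝[>] (0 : ℝ)) (𝓝 (D.pt 0)) := by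
    rw [hD, unitDisc_pt_zero]; exact tendsto_meshPoint_nearestSite 1
  have hb : Tendsto (fun δ => meshPoint δ (b δ)) (𝓝[>] (0 : ℝ)) (𝓝 (D.pt 1)) := by
    rw [hD, unitDisc_pt_one]; exact tendsto_meshPoint_outside
  have hlaw : ∀ {δ : ℝ}, 0 < δ → law D.carrier δ (a δ) (b δ) = 0 := by
    intro δ hδ
    have hout : b δ ∉ meshDomain D.carrier δ := fun hm => by
      have hin : meshPoint δ (b δ) ∈ Metric.ball (0 : ℂ) 1 := meshDomain_subset_meshVertices _ _ hm
      rw [Metric.mem_ball, dist_zero_right] at hin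
      have := norm_meshPoint_outside hδ
      change 1 + 2 * δ ≤ ‖meshPoint δ (b δ)‖ at this
      linarith
    have hne : a δ ≠ b δ := by
      intro hab
      have h1 : ‖meshPoint δ (a δ)‖ ≤ 1 + δ := by
        have := dist_meshPoint_nearestSite_le hδ (1 : ℂ)
        rw [dist_eq_norm] at this
        have h' := norm_le_norm_add_norm_sub' (meshPoint δ (nearestSite δ 1)) (1 : ℂ)
        rw [norm_one] at h'
        show ‖meshPoint δ (nearestSite δ 1)‖ ≤ 1 + δ
        linarith
      have h2 := norm_meshPoint_outside hδ
      rw [hab] at h1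
      change 1 + 2 * δ ≤ ‖meshPoint δ (b δ)‖ at h2
      linarith
    exact law_eq_zero_of_not_mem hne hout
  have hw : WeakLimitAlong D a b (fun n => 1 / ((n : ℝ) + 1)) ν := by
    intro f
    have hl : ∀ n : ℕ, ∫ γ, f γ.curve ∂(law D.carrier (1 / ((n : ℝ) + 1)) (a (1 / ((n : ℝ) + 1)))
        (b (1 / ((n : ℝ) + 1)))) = 0 := fun n => by
      rw [hlaw (by positivity)]; simp
    have hr : ∫ x, f x ∂ν = 0 := by
      simp only [ν, integral_smul_measure, ENNReal.toReal_top, zero_smul]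
    simp only [hl, hr]
    exact tendsto_const_nhds
  have hae := h D a b ha hb _ ν tendsto_one_div_succ hw
  rw [Measure.ae_ennreal_smul_measure_eq ENNReal.top_ne_zero] at hae
  exact not_ae_simple_dirac_const 0 (hae.mono fun γ hγ => hγ.1)

end ProbabilityIdle

/-! ## §12 The mesh hypothesis `s n → 0⁺`: both the LIMIT and the SIDE are load-bearing (gen 2) -/

section MeshHypothesis

/-- `S` with `Tendsto s atTop (𝓝[>] 0)` weakened to mere positivity `∀ n, 0 < s n`. -/
def CruxWithoutMeshLimit : Prop :=
  ∀ (D : DobrushinDomain) (a b : ℝ → Site 2), IsEndpointApprox D a b →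
    ∀ (s : ℕ → ℝ) (ν : Measure (CurveClass ℂ)), (∀ n, 0 < s n) →
      IsProbabilityMeasure ν → WeakLimitAlong D a b s ν → ∀ᵐ γ ∂ν, Carrier D γ

/-- **The limit `s n → 0` is load-bearing**: `S` with only `0 < s n` is FALSE. Witness: any domain, any
honest approximation, the CONSTANT sequence `s ≡ δ₁` at a small honest mesh; the weak limit is the
pushed-forward law at mesh `δ₁` itself, a probability measure carried by polylines whose source is the
interior mesh point `δ₁ · a δ₁ ≠ a` (§10). -/
theorem crux_false_without_meshLimit : ¬ CruxWithoutMeshLimit := by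
  intro h
  set D := DobrushinDomain.unitDisc with hD
  obtain ⟨a, b, hab⟩ := exists_isEndpointApprox D
  obtain ⟨δ₁, hP, hne, hδ₁⟩ := ((eventually_isProbabilityMeasure_law hab).and
    ((eventually_ne_nhdsGT hab).and self_mem_nhdsWithin)).exists
  haveI := hP
  let P := law D.carrier δ₁ (a δ₁) (b δ₁)
  let ν : Measure (CurveClass ℂ) := P.map fun γ => γ.curve
  haveI hν : IsProbabilityMeasure ν :=
    Measure.isProbabilityMeasure_map (DomainSAW.measurable_of_top _).aemeasurable
  have hw : WeakLimitAlong D a b (fun _ => δ₁) ν := by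
    intro f
    have : ∫ x, f x ∂ν = ∫ γ, f γ.curve ∂P :=
      integral_map (DomainSAW.measurable_of_top _).aemeasurable f.continuous.aestronglyMeasurable
    rw [this]
    exact tendsto_const_nhds
  have hae := h D a b hab (fun _ => δ₁) ν (fun _ => hδ₁) hν hw
  have hae' : ∀ᵐ γ ∂P, Carrier D γ.curve :=
    ae_of_ae_map (DomainSAW.measurable_of_top _).aemeasurable hae
  have hfalse : ∀ᵐ γ ∂P, False :=
    hae'.mono fun γ hγ => curve_source_ne_pt hne γ hγ.2.1
  rw [eventually_false_iff_eq_bot, ae_eq_bot] at hfalse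
  exact (IsProbabilityMeasure.ne_zero P) hfalse

/-- `S` with `Tendsto s atTop (𝓝[>] 0)` weakened to the TWO-SIDED `Tendsto s atTop (𝓝 0)`. -/
def CruxWithTwoSidedMeshLimit : Prop :=
  ∀ (D : DobrushinDomain) (a b : ℝ → Site 2), IsEndpointApprox D a b →
    ∀ (s : ℕ → ℝ) (ν : Measure (CurveClass ℂ)), Tendsto s atTop (𝓝 (0 : ℝ)) →
      IsProbabilityMeasure ν → WeakLimitAlong D a b s ν → ∀ᵐ γ ∂ν, Carrier D γ

/-- `IsEndpointApprox` only sees `δ > 0`: overriding the endpoints at `δ ≤ 0` preserves it. -/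
theorem isEndpointApprox_override {D : DobrushinDomain} {a b : ℝ → Site 2} (hab : IsEndpointApprox D a b)
    (e : Site 2) :
    IsEndpointApprox D (fun δ => if 0 < δ then a δ else e) (fun δ => if 0 < δ then b δ else e) := by
  have hev : ∀ᶠ δ in 𝓝[>] (0 : ℝ), 0 < δ := self_mem_nhdsWithin
  refine ⟨?_, ?_, ?_⟩
  · filter_upwards [hab.reachable, hev] with δ hr hδ
    simp only [if_pos hδ]
    exact hr
  · refine hab.tendsto_fst.congr' ?_
    filter_upwards [hev] with δ hδ
    simp only [if_pos hδ]
  · refine hab.tendsto_snd.congr' ?_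
    filter_upwards [hev] with δ hδ
    simp only [if_pos hδ]

/-- The mesh point of the origin is the origin at every mesh. -/
theorem meshPoint_zero_site (δ : ℝ) : meshPoint δ (0 : Site 2) = 0 := by
  apply Complex.ext <;> simp

/-- **The side `> 0` is load-bearing**: `S` with the two-sided `s n → 0` is FALSE. Witness: the unit disc,
an honest approximation overridden at `δ ≤ 0` by the coincident endpoints `0, 0` (where
`IsEndpointApprox` says nothing), `s n = -1/(n+1)`: every law along the sequence is the Dirac mass at
the trivial walk, the weak limit is the Dirac mass at the constant curve at `0`, not simple. -/
theorem crux_false_with_twoSidedMeshLimit : ¬ CruxWithTwoSidedMeshLimit := by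
  intro h
  set D := DobrushinDomain.unitDisc with hD
  obtain ⟨a, b, hab⟩ := exists_isEndpointApprox D
  have hab' := isEndpointApprox_override hab 0
  let s : ℕ → ℝ := fun n => -(1 / ((n : ℝ) + 1))
  have hs : Tendsto s atTop (𝓝 (0 : ℝ)) := by
    have h0 : Tendsto (fun n : ℕ => 1 / ((n : ℝ) + 1)) atTop (𝓝 (0 : ℝ)) :=
      tendsto_one_div_add_atTop_nhds_zero_nat
    have h1 := h0.neg
    rw [neg_zero] at h1
    exact h1
  have hsn : ∀ n, ¬ (0 < s n) := fun n => by
    simp only [s, not_lt, neg_nonpos]; positivity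
  let ν : Measure (CurveClass ℂ) := Measure.dirac (CurveClass.mk (Curve.const 0))
  have hw : WeakLimitAlong D (fun δ => if 0 < δ then a δ else 0) (fun δ => if 0 < δ then b δ else 0) s ν := by
    intro f
    have hl : ∀ n, ∫ γ, f γ.curve ∂(law D.carrier (s n) (if 0 < s n then a (s n) else 0)
        (if 0 < s n then b (s n) else 0)) = f (CurveClass.mk (Curve.const 0)) := fun n => by
      rw [integral_law_congr (if_neg (hsn n)) (if_neg (hsn n)), integral_law_self, meshPoint_zero_site]
    simp only [hl, ν, integral_dirac]
    exact tendsto_const_nhds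
  have hae := h D _ _ hab' s ν hs inferInstance hw
  exact not_ae_simple_dirac_const 0 (hae.mono fun γ hγ => hγ.1)

/-- `S` with the weak-convergence hypothesis DROPPED. -/
def CruxWithoutWeakLimit : Prop :=
  ∀ (D : DobrushinDomain) (a b : ℝ → Site 2), IsEndpointApprox D a b →
    ∀ (s : ℕ → ℝ) (ν : Measure (CurveClass ℂ)), Tendsto s atTop (𝓝[>] (0 : ℝ)) →
      IsProbabilityMeasure ν → ∀ᵐ γ ∂ν, Carrier D γ

/-- Dropping the convergence hypothesis is (of course) fatal: `ν` = Dirac mass at a constant curve. -/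
theorem crux_false_without_weakLimit : ¬ CruxWithoutWeakLimit := by
  intro h
  obtain ⟨a, b, hab⟩ := exists_isEndpointApprox DobrushinDomain.unitDisc
  have hae := h _ a b hab (fun n => 1 / ((n : ℝ) + 1)) (Measure.dirac (CurveClass.mk (Curve.const 0)))
    tendsto_one_div_succ inferInstance
  exact not_ae_simple_dirac_const 0 (hae.mono fun γ hγ => hγ.1)

/-- **THE COMPLETE HYPOTHESIS LEDGER OF `S`** (§2, §6, §11, §12 assembled): each one-hypothesis weakening
is either EQUIVALENT to `S` (`reachable` dropped; `IsProbabilityMeasure ν` dropped) or FALSE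
(`tendsto_fst`, `tendsto_snd`, the limit `s n → 0`, the side `s n > 0`, the weak convergence); and the
two idle hypotheses are jointly load-bearing. Any proof of `S` uses exactly: both endpoint limits,
`s n → 0⁺` in full, the convergence, and ONE of {`reachable`, `IsProbabilityMeasure ν`}. -/
theorem crux_hypothesis_ledger :
    (Crux ↔ CruxWithoutIsProbability) ∧ (Crux ↔ CruxWithoutReachable) ∧
    ¬ CruxWithoutIsProbabilityAndReachable ∧
    ¬ CruxWithoutMeshLimit ∧ ¬ CruxWithTwoSidedMeshLimit ∧ ¬ CruxWithoutWeakLimit ∧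
    ¬ CruxWithoutTendstoFst ∧ ¬ CruxWithoutTendstoSnd :=
  ⟨crux_iff_withoutIsProbability, crux_iff_withoutReachable,
    crux_false_without_isProbability_and_reachable,
    crux_false_without_meshLimit, crux_false_with_twoSidedMeshLimit, crux_false_without_weakLimit,
    simpleSubseqLimits_false_without_tendsto_fst, simpleSubseqLimits_false_without_tendsto_snd⟩

end MeshHypothesis

/-! ## §13 INTERIOR ROOTS are in the crux's quantifier (gen 2; triage finding F2 made formal) -/

section InteriorRoots

/-- Adjacent sites have mesh points at distance `≤ δ` (`δ ≥ 0`). -/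
theorem dist_meshPoint_le_of_adj {δ : ℝ} (hδ : 0 ≤ δ) {x y : Site 2} (h : (zdGraph 2).Adj x y) :
    dist (meshPoint δ x) (meshPoint δ y) ≤ δ := by
  have key : ∀ (u : Site 2) (i : Fin 2),
      dist (meshPoint δ u) (meshPoint δ (u + Pi.single i 1)) ≤ δ := by
    intro u i
    rw [Complex.dist_eq]
    have hre : (meshPoint δ u - meshPoint δ (u + Pi.single i 1)).re =
        -(δ * (Pi.single (M := fun _ : Fin 2 => ℤ) i (1 : ℤ) 0 : ℤ)) := by
      simp only [Complex.sub_re, meshPoint_re, Pi.add_apply, Int.cast_add]; ring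
    have him : (meshPoint δ u - meshPoint δ (u + Pi.single i 1)).im =
        -(δ * (Pi.single (M := fun _ : Fin 2 => ℤ) i (1 : ℤ) 1 : ℤ)) := by
      simp only [Complex.sub_im, meshPoint_im, Pi.add_apply, Int.cast_add]; ring
    rw [← Complex.re_add_im (meshPoint δ u - meshPoint δ (u + Pi.single i 1)), hre, him]
    fin_cases i
    · simp [Complex.norm_real, abs_of_nonneg hδ]
    · simp [abs_of_nonneg hδ]
  obtain ⟨i, rfl | rfl⟩ := (zdGraph_adj_iff x y).1 h
  · exact key x i
  · rw [dist_comm]; exact key y i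

/-- A site is an **interior vertex** of `Ω_δ`: each of its four lattice neighbours is joined to it in
`Ω_δ` (so all five sites lie in `meshDomain Ω δ`, and the first step of a walk from it leaves an ISLAND
past: the slit domain is doubly connected). -/
def IsInteriorVertex (Ω : Set ℂ) (δ : ℝ) (x : Site 2) : Prop :=
  ∀ y : Site 2, (zdGraph 2).Adj x y → (discreteDomainGraph Ω δ).Adj x y

/-- If the closed disc of radius `r ≥ 2δ` about a point within `δ` of the mesh point of `x` lies in `Ω`
and every site with mesh point in it lies in `Ω_δ`, then `x` is an interior vertex. -/
theorem isInteriorVertex_of_closedBall {Ω : Set ℂ} {δ : ℝ} (hδ : 0 < δ) {x : Site 2} {z : ℂ} {r : ℝ}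
    (hx : dist (meshPoint δ x) z ≤ δ) (hr : 2 * δ ≤ r) (hΩ : closedBall z r ⊆ Ω)
    (hin : ∀ y : Site 2, meshPoint δ y ∈ closedBall z r → y ∈ meshDomain Ω δ) :
    IsInteriorVertex Ω δ x := by
  intro y hxy
  have hy : dist (meshPoint δ y) z ≤ 2 * δ :=
    calc dist (meshPoint δ y) z ≤ dist (meshPoint δ y) (meshPoint δ x) + dist (meshPoint δ x) z :=
          dist_triangle _ _ _
      _ ≤ δ + δ := add_le_add (by rw [dist_comm]; exact dist_meshPoint_le_of_adj hδ.le hxy) hx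
      _ = 2 * δ := by ring
  have hxB : meshPoint δ x ∈ closedBall z r := mem_closedBall.2 (hx.trans (by linarith))
  have hyB : meshPoint δ y ∈ closedBall z r := mem_closedBall.2 (hy.trans hr)
  refine discreteDomainGraph_adj_iff.2 ⟨meshGraph_adj_iff.2 ⟨hxy, ?_⟩, hin _ hxB, hin _ hyB⟩
  exact ((convex_closedBall z r).segment_subset hxB hyB).trans (hΩ.trans subset_closure)

/-- **Interior-rooted endpoint approximations exist in EVERY Dobrushin domain**: lattice endpoints
`a δ`, `b δ` forming an `IsEndpointApprox` such that, for all small `δ > 0`, BOTH are interior vertices of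
`Ω_δ` (degree four). Construction: as `SAW.exists_isEndpointApprox` (interior points `z_n → a`,
`w_n → b`, closed discs of radius `r_n` inside `Ω`, bulk lemma
`JordanDomain.exists_forall_mem_meshDomain_and_reachable`, diagonal stage selection) with the stage
threshold sharpened to `2δ ≤ r_n`. CONSEQUENCE FOR THE LINES: the crux (and the summit) quantify over
these approximations; after one step the conditional slit domain is doubly connected, KS admissibility
(boundary-vertex roots, stmt-11346) fails, so every KS-fed line needs an explicit interior-root reduction
(reversal `law(D;a,b) = rev ∘ law(D;b,a)` covers ONE interior endpoint, never two). -/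
theorem exists_isEndpointApprox_interior (D : DobrushinDomain) :
    ∃ a b : ℝ → Site 2, IsEndpointApprox D a b ∧
      ∀ᶠ δ in 𝓝[>] (0 : ℝ), IsInteriorVertex D.carrier δ (a δ) ∧ IsInteriorVertex D.carrier δ (b δ) := by
  classical
  have hz : ∀ (i : Fin 2) (n : ℕ), ∃ z ∈ D.carrier, dist z (D.pt i) < 1 / ((n : ℝ) + 1) ∧
      ∃ r > 0, closedBall z r ⊆ D.carrier := by
    intro i n
    obtain ⟨z, hz, hd⟩ := Metric.mem_closure_iff.1
      (frontier_subset_closure (D.pt_mem_frontier i)) (1 / ((n : ℝ) + 1)) (by positivity)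
    obtain ⟨r, hr, hsub⟩ := Metric.isOpen_iff.1 D.isOpen z hz
    exact ⟨z, hz, by rwa [dist_comm], r / 2, by positivity,
      (closedBall_subset_ball (by linarith)).trans hsub⟩
  choose z hzΩ hzd r hr hrΩ using hz
  set K : ℕ → Set ℂ := fun n => closedBall (z 0 n) (r 0 n) ∪ closedBall (z 1 n) (r 1 n)
    with hK_def
  have hKc : ∀ n, IsCompact (K n) := fun n =>
    (isCompact_closedBall _ _).union (isCompact_closedBall _ _)
  have hKΩ : ∀ n, K n ⊆ D.carrier := fun n => union_subset (hrΩ 0 n) (hrΩ 1 n)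
  have hstage := fun n =>
    D.toJordanDomain.exists_forall_mem_meshDomain_and_reachable (hKc n) (hKΩ n)
  choose δ₀ hδ₀ hgood using hstage
  obtain ⟨N, hN, hNtop⟩ := exists_stage_tendsto_atTop
    (p := fun n δ => 0 < δ ∧ δ < min (δ₀ n) (min (r 0 n / 2) (r 1 n / 2)))
    (ε := fun n => min (δ₀ n) (min (r 0 n / 2) (r 1 n / 2)))
    (fun n => lt_min (hδ₀ n) (lt_min (half_pos (hr 0 n)) (half_pos (hr 1 n))))
    (fun n δ h₁ h₂ => ⟨h₁, h₂⟩)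
  have hmem : ∀ (i : Fin 2) (δ : ℝ), 0 < δ → δ < r i (N δ) / 2 →
      meshPoint δ (nearestSite δ (z i (N δ))) ∈ closedBall (z i (N δ)) (r i (N δ)) :=
    fun i δ hδ hri => mem_closedBall.2 ((dist_meshPoint_nearestSite_le hδ _).trans (by linarith))
  refine ⟨fun δ => nearestSite δ (z 0 (N δ)), fun δ => nearestSite δ (z 1 (N δ)), ⟨?_,
    tendsto_meshPoint_nearestSite_of_tendsto (hzd 0) hNtop,
    tendsto_meshPoint_nearestSite_of_tendsto (hzd 1) hNtop⟩, ?_⟩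
  · filter_upwards [hN] with δ ⟨hδ, hlt⟩
    have hδ₀' : δ < δ₀ (N δ) := hlt.trans_le (min_le_left _ _)
    have hr0 : δ < r 0 (N δ) / 2 := hlt.trans_le ((min_le_right _ _).trans (min_le_left _ _))
    have hr1 : δ < r 1 (N δ) / 2 := hlt.trans_le ((min_le_right _ _).trans (min_le_right _ _))
    obtain ⟨hin, hconn⟩ := hgood (N δ) δ hδ hδ₀'
    have ha := hin _ (Or.inl (hmem 0 δ hδ hr0))
    have hb := hin _ (Or.inr (hmem 1 δ hδ hr1))
    obtain ⟨_, _, ⟨q⟩⟩ := hconn _ ha _ hb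
    exact reachable_discreteDomainGraph_of_walk q ha
  · filter_upwards [hN] with δ ⟨hδ, hlt⟩
    have hδ₀' : δ < δ₀ (N δ) := hlt.trans_le (min_le_left _ _)
    have hr0 : δ < r 0 (N δ) / 2 := hlt.trans_le ((min_le_right _ _).trans (min_le_left _ _))
    have hr1 : δ < r 1 (N δ) / 2 := hlt.trans_le ((min_le_right _ _).trans (min_le_right _ _))
    obtain ⟨hin, -⟩ := hgood (N δ) δ hδ hδ₀'
    constructor
    · exact isInteriorVertex_of_closedBall hδ (dist_meshPoint_nearestSite_le hδ _) (by linarith)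
        (hrΩ 0 (N δ)) fun y hy => hin y (Or.inl hy)
    · exact isInteriorVertex_of_closedBall hδ (dist_meshPoint_nearestSite_le hδ _) (by linarith)
        (hrΩ 1 (N δ)) fun y hy => hin y (Or.inr hy)

/-- The crux restricted to interior-rooted approximations is a genuine special case (non-vacuous
antecedent in every domain): `S` implies it, and it is NOT provable by restricting attention to
boundary-vertex roots. -/
def CruxInteriorRooted : Prop :=
  ∀ (D : DobrushinDomain) (a b : ℝ → Site 2), IsEndpointApprox D a b →
    (∀ᶠ δ in 𝓝[>] (0 : ℝ), IsInteriorVertex D.carrier δ (a δ) ∧ IsInteriorVertex D.carrier δ (b δ)) →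
    ∀ (s : ℕ → ℝ) (ν : Measure (CurveClass ℂ)), Tendsto s atTop (𝓝[>] (0 : ℝ)) →
      IsProbabilityMeasure ν → WeakLimitAlong D a b s ν → ∀ᵐ γ ∂ν, Carrier D γ

/-- `S` ⇒ its interior-rooted special case (whose antecedent is inhabited in every domain by
`exists_isEndpointApprox_interior`). -/
theorem cruxInteriorRooted_of_crux (h : Crux) : CruxInteriorRooted :=
  fun D a b hab _ s ν hs hν hw => h D a b hab s ν hs hν hw

end InteriorRoots

/-! ## §14 PRE-KILL of a typed first lemma: `simple_of_dense_pastFuture` dies on constant curves (gen 2) -/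

section DensePastFuture

/-- The first lemma of card `slit-continuous-restriction` AS TYPED in
`Cruxes/SimpleSubseqLimits/Ideator3Sketch.lean` (`simple_of_dense_pastFuture`), restated verbatim as a
proposition: a dense set of times at which the future range meets the past range only at the present
point forces the class to be simple. -/
def DensePastFutureLemma : Prop :=
  ∀ (γ : Curve ℂ) (T : Set unitInterval), Dense T →
    (∀ t ∈ T, γ '' Set.Ici t ∩ γ '' Set.Iic t = {γ t}) → CurveClass.mk γ ∈ CurveClass.simple

/-- For a constant curve, past and future ranges are the singleton at every time. -/
theorem const_image_inter (p : ℂ) (t : unitInterval) :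
    (Curve.const p) '' Set.Ici t ∩ (Curve.const p) '' Set.Iic t = {(Curve.const p) t} := by
  have h1 : (Curve.const p) '' Set.Ici t = {p} := by
    ext w
    simp only [mem_image, mem_Ici, Curve.const_apply, mem_singleton_iff]
    exact ⟨fun ⟨_, _, h⟩ => h.symm, fun h => ⟨t, le_rfl, h.symm⟩⟩
  have h2 : (Curve.const p) '' Set.Iic t = {p} := by
    ext w
    simp only [mem_image, mem_Iic, Curve.const_apply, mem_singleton_iff]
    exact ⟨fun ⟨_, _, h⟩ => h.symm, fun h => ⟨t, le_rfl, h.symm⟩⟩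
  rw [h1, h2, inter_self, Curve.const_apply]

/-- **`simple_of_dense_pastFuture` is FALSE as typed**: the constant curve at `0` with `T = univ`
satisfies every hypothesis, and its class is not simple (`mk_const_not_mem_simple`). Minimal repair `C′`:
add `γ 0 ≠ γ 1` (in the line's use `a ≠ b`): then the hypothesis makes the fibres of `γ` intervals and a
light reparametrisation is injective — the witness misses `C′` (the other typed deterministic lemmas of
the round, `simple_of_arc_range_of_strictGrowth` [PROVED by its author], `ArcClock`,
`mk_mem_simple_of_eq_comp_monotone`, `carrier_of_shape_of_order`, are TRUE on paper: `CurveClass` is the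
separation quotient of the reparametrisation pseudometric, so monotone reparametrisations are invisible). -/
theorem not_densePastFutureLemma : ¬ DensePastFutureLemma := fun h =>
  mk_const_not_mem_simple 0 (h (Curve.const 0) univ dense_univ fun t _ => const_image_inter 0 t)

end DensePastFuture


/-! # Gen 3 (line `marked-point-revisit`): the line's vocabulary is imported VERBATIM from the drefuter's
checked file `DrefuteReshapedStubs` (same predicates as the registered skeleton `Lines/marked-point-revisit.lean`). -/

open scoped unitInterval

open Summit.CriticalPhenomena.SAWScalingLimit.Cruxes.SimpleSubseqLimits.MarkedPointRevisit
  (MarkedConfig NearRevisit nearRevisitEvent latticeCurve mk_latticeCurve NoMarkedRevisitFor NoTouchAt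
   nearRevisit_mono not_mem_closure_nearRevisitEvent_forall_of_simple)

/-! ## §15 ORDER is blind to KISSES: `NoMarkedRevisitFor` holds at a non-simple limit of simple curves (gen 3) -/

section Kiss

/-- Real profile of the `x`-coordinate of the kiss curves: `0 → 2` on `[0, 1/4]`, `2` on
`[1/4, 1/2]`, `2 → 0` on `[1/2, 1]`. -/
def kissX (t : ℝ) : ℝ := min (min (8 * t) 2) (4 - 4 * t)

/-- Real profile of the `y`-coordinate of the kiss curve with touch height `h`: `0` on `[0, 1/4]`,
`0 → 1` on `[1/4, 1/2]`, the `V`-shape `1 → h → 1` on `[1/2, 1]` with its minimum `h` at `t = 3/4`. -/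
def kissY (h t : ℝ) : ℝ := max 0 (min (4 * t - 1) (h + (1 - h) * |4 * t - 3|))

theorem continuous_kissX : Continuous kissX := by unfold kissX; fun_prop

theorem continuous_kissY (h : ℝ) : Continuous (kissY h) := by unfold kissY; fun_prop

/-- **The kiss curves** `kissAt h`, polygonal through `0, 2, 2 + i, 1 + h i, i`: for `0 < h < 1`
an INJECTIVE polygon; for `h = 0` the fourth vertex `1` lies on the first edge `[0, 2]` — the curve
comes back, TOUCHES its past at the single point `1` from above and leaves upwards (a *kiss*: one
double point, no retracing, no crossing). -/
def kissAt (h : ℝ) : Curve ℂ :=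
  ⟨⟨fun t => ((kissX t : ℝ) : ℂ) + Complex.I * ((kissY h t : ℝ) : ℂ), by
    have := continuous_kissX; have := continuous_kissY h; fun_prop⟩⟩

/-- The kiss curve (touch height `0`). -/
def kiss : Curve ℂ := kissAt 0

@[simp] theorem kissAt_apply (h : ℝ) (t : I) :
    kissAt h t = ((kissX t : ℝ) : ℂ) + Complex.I * ((kissY h t : ℝ) : ℂ) := rfl

theorem kissAt_re (h : ℝ) (t : I) : (kissAt h t).re = kissX t := by
  simp [Complex.add_re, Complex.mul_re]

theorem kissAt_im (h : ℝ) (t : I) : (kissAt h t).im = kissY h t := by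
  simp [Complex.add_im, Complex.mul_im]

theorem kissX_of_le {t : ℝ} (ht : t ≤ 1 / 4) : kissX t = 8 * t := by
  unfold kissX
  rw [min_eq_left (by linarith : 8 * t ≤ 2), min_eq_left (by linarith : 8 * t ≤ 4 - 4 * t)]

theorem kissX_of_mem {t : ℝ} (h₁ : 1 / 4 ≤ t) (h₂ : t ≤ 1 / 2) : kissX t = 2 := by
  unfold kissX
  rw [min_eq_right (by linarith : 2 ≤ 8 * t), min_eq_left (by linarith : (2 : ℝ) ≤ 4 - 4 * t)]

theorem kissX_of_ge {t : ℝ} (ht : 1 / 2 ≤ t) : kissX t = 4 - 4 * t := by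
  unfold kissX
  exact min_eq_right (le_min (by linarith) (by linarith))

theorem kissY_of_le (h : ℝ) {t : ℝ} (ht : t ≤ 1 / 4) : kissY h t = 0 := by
  unfold kissY
  exact max_eq_left ((min_le_left _ _).trans (by linarith))

theorem kissY_of_mem {h t : ℝ} (hh : h ≤ 1) (h₁ : 1 / 4 ≤ t) (h₂ : t ≤ 1 / 2) :
    kissY h t = 4 * t - 1 := by
  unfold kissY
  have habs : |4 * t - 3| = 3 - 4 * t := by
    rw [abs_of_nonpos (by linarith)]; ring
  rw [habs, min_eq_left (by nlinarith), max_eq_right (by linarith)]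

theorem kissY_of_ge {h t : ℝ} (hh₀ : 0 ≤ h) (hh : h ≤ 1) (h₁ : 1 / 2 ≤ t) (h₂ : t ≤ 1) :
    kissY h t = h + (1 - h) * |4 * t - 3| := by
  unfold kissY
  have habs : |4 * t - 3| ≤ 1 := abs_le.2 ⟨by linarith, by linarith⟩
  have hnn : 0 ≤ (1 - h) * |4 * t - 3| := mul_nonneg (by linarith) (abs_nonneg _)
  rw [min_eq_right (by nlinarith), max_eq_right (by linarith)]

/-- **The double points of the kiss curves.** For `0 ≤ h < 1`, `kissAt h s = kissAt h t` with
`s < t` forces `h = 0`, `s = 1/8`, `t = 3/4`: the polygon `kissAt h` is injective for `h > 0`, and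
`kiss = kissAt 0` has exactly ONE pair of double times, `kiss (1/8) = kiss (3/4) = 1`. -/
theorem kissAt_eq_kissAt {h : ℝ} (hh₀ : 0 ≤ h) (hh₁ : h < 1) {s t : I} (hst : s < t)
    (heq : kissAt h s = kissAt h t) : h = 0 ∧ (s : ℝ) = 1 / 8 ∧ (t : ℝ) = 3 / 4 := by
  have hx : kissX s = kissX t := by simpa [kissAt_re] using congrArg Complex.re heq
  have hy : kissY h s = kissY h t := by simpa [kissAt_im] using congrArg Complex.im heq
  have hs0 := s.2.1; have hs1 := s.2.2; have ht0 := t.2.1; have ht1 := t.2.2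
  have hst' : (s : ℝ) < t := hst
  rcases le_or_gt (t : ℝ) (1 / 2) with ht | ht
  · rcases lt_or_ge (s : ℝ) (1 / 4) with hs | hs
    · rw [kissX_of_le hs.le] at hx
      rcases le_or_gt (t : ℝ) (1 / 4) with ht' | ht'
      · rw [kissX_of_le ht'] at hx; exact absurd hx (by linarith)
      · rw [kissX_of_mem ht'.le ht] at hx; exact absurd hx (by linarith)
    · rw [kissY_of_mem hh₁.le hs (hst'.le.trans ht), kissY_of_mem hh₁.le (hs.trans hst'.le) ht] at hy
      exact absurd hy (by linarith)
  · rcases lt_or_ge (s : ℝ) (1 / 2) with hs | hs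
    · rw [kissX_of_ge ht.le] at hx
      have hs4 : (s : ℝ) < 1 / 4 := by
        by_contra hcon
        rw [kissX_of_mem (not_lt.1 hcon) hs.le] at hx
        linarith
      rw [kissX_of_le hs4.le] at hx
      rw [kissY_of_le h hs4.le, kissY_of_ge hh₀ hh₁.le ht.le ht1] at hy
      have habs : 0 ≤ |4 * (t : ℝ) - 3| := abs_nonneg _
      have h1h : 0 < 1 - h := by linarith
      have hprod : 0 ≤ (1 - h) * |4 * (t : ℝ) - 3| := mul_nonneg h1h.le habs
      have hh : h = 0 := by linarith
      have habs0 : |4 * (t : ℝ) - 3| = 0 := by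
        have : (1 - h) * |4 * (t : ℝ) - 3| = 0 := by linarith
        rcases mul_eq_zero.1 this with h' | h'
        · exact absurd h' h1h.ne'
        · exact h'
      have ht34 : (t : ℝ) = 3 / 4 := by
        have := abs_eq_zero.1 habs0; linarith
      exact ⟨hh, by rw [ht34] at hx; linarith, ht34⟩
    · rw [kissX_of_ge hs, kissX_of_ge ht.le] at hx
      exact absurd hx (by linarith)

/-- For `0 < h < 1` the kiss polygon is a simple curve. -/
theorem kissAt_isSimple {h : ℝ} (hh₀ : 0 < h) (hh₁ : h < 1) : (kissAt h).IsSimple := by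
  intro s t heq
  rcases lt_trichotomy s t with hst | hst | hst
  · exact absurd (kissAt_eq_kissAt hh₀.le hh₁ hst heq).1 hh₀.ne'
  · exact hst
  · exact absurd (kissAt_eq_kissAt hh₀.le hh₁ hst heq.symm).1 hh₀.ne'

/-- The double times of the kiss curve. -/
theorem kiss_eq_kiss {s t : I} (hst : s < t) (heq : kiss s = kiss t) :
    (s : ℝ) = 1 / 8 ∧ (t : ℝ) = 3 / 4 :=
  (kissAt_eq_kissAt le_rfl one_pos hst heq).2

/-- The kiss point: `kiss s = 1` whenever `s = 1/8`. -/
theorem kiss_apply_of_eq {s : I} (hs : (s : ℝ) = 1 / 8) : kiss s = 1 := by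
  apply Complex.ext
  · rw [kiss, kissAt_re, kissX_of_le (by rw [hs]; norm_num), hs]; norm_num
  · rw [kiss, kissAt_im, kissY_of_le 0 (by rw [hs]; norm_num)]; norm_num

/-- The kiss curve is not flat: `kiss (1/8) = kiss (3/4) = 1` but `kiss (1/2) = 2 + i`. -/
theorem kiss_not_isFlat : ¬ kiss.IsFlat := by
  intro hfl
  have hs : ((1 : ℝ) / 8) ∈ I := ⟨by norm_num, by norm_num⟩
  have hu : ((1 : ℝ) / 2) ∈ I := ⟨by norm_num, by norm_num⟩
  have ht : ((3 : ℝ) / 4) ∈ I := ⟨by norm_num, by norm_num⟩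
  have h1 : kiss ⟨_, hs⟩ = 1 := kiss_apply_of_eq rfl
  have h2 : kiss ⟨_, ht⟩ = 1 := by
    apply Complex.ext
    · rw [kiss, kissAt_re, kissX_of_ge (by norm_num)]; norm_num
    · rw [kiss, kissAt_im, kissY_of_ge le_rfl zero_le_one (by norm_num) (by norm_num)]; norm_num
  have key := hfl ⟨_, hs⟩ ⟨_, hu⟩ ⟨_, ht⟩ (Subtype.mk_le_mk.2 (by norm_num))
    (Subtype.mk_le_mk.2 (by norm_num)) (h1.trans h2.symm)
  have := congrArg Complex.re key
  rw [h1, kiss, kissAt_re, kissX_of_mem (by norm_num) (by norm_num)] at this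
  norm_num at this

/-- **The class of the kiss curve is not simple** (only flat curves have simple classes). -/
theorem mk_kiss_not_mem_simple : CurveClass.mk kiss ∉ CurveClass.simple := fun h =>
  kiss_not_isFlat (isFlat_of_mk_mem_simple h)

/-- The kiss polygons are uniformly `h`-close to the kiss curve (`0 ≤ h ≤ 1`). -/
theorem dist_kissAt_kiss_le {h : ℝ} (hh₀ : 0 ≤ h) (hh₁ : h ≤ 1) : dist (kissAt h) kiss ≤ h := by
  refine (Curve.dist_le_dist_toContinuousMap _ _).trans ?_
  refine (ContinuousMap.dist_le hh₀).2 fun t => ?_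
  change dist (kissAt h t) (kiss t) ≤ h
  rw [kiss, kissAt_apply, kissAt_apply, Complex.dist_eq, add_sub_add_left_eq_sub, ← mul_sub,
    norm_mul, Complex.norm_I, one_mul, ← Complex.ofReal_sub, Complex.norm_real, Real.norm_eq_abs]
  rcases le_or_gt (t : ℝ) (1 / 2) with ht | ht
  · rcases le_or_gt (t : ℝ) (1 / 4) with ht' | ht'
    · rw [kissY_of_le h ht', kissY_of_le 0 ht']; simpa using hh₀
    · rw [kissY_of_mem hh₁ ht'.le ht, kissY_of_mem zero_le_one ht'.le ht]; simpa using hh₀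
  · rw [kissY_of_ge hh₀ hh₁ ht.le t.2.2, kissY_of_ge le_rfl zero_le_one ht.le t.2.2]
    have habs : |4 * (t : ℝ) - 3| ≤ 1 := abs_le.2 ⟨by linarith [t.2.2], by linarith [t.2.2]⟩
    have habs0 : 0 ≤ |4 * (t : ℝ) - 3| := abs_nonneg _
    rw [abs_le]
    constructor <;> nlinarith

/-- The simple classes `mk (kissAt (1/(n+2)))` converge to the kiss class. -/
theorem tendsto_mk_kissAt :
    Tendsto (fun n : ℕ => CurveClass.mk (kissAt (1 / ((n : ℝ) + 2)))) atTop
      (𝓝 (CurveClass.mk kiss)) := by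
  rw [tendsto_iff_dist_tendsto_zero]
  have h2 : Tendsto (fun n : ℕ => 1 / ((n : ℝ) + 2)) atTop (𝓝 0) := by
    have := tendsto_one_div_add_atTop_nhds_zero_nat (𝕜 := ℝ)
    refine squeeze_zero (fun n => by positivity) (fun n => ?_) this
    exact one_div_le_one_div_of_le (by positivity) (by linarith)
  refine squeeze_zero (fun _ => dist_nonneg) (fun n => ?_) h2
  rw [CurveClass.dist_mk_mk]
  exact dist_kissAt_kiss_le (by positivity) (by
    rw [div_le_one (by positivity)]; linarith [n.cast_nonneg (α := ℝ)])

/-- The kiss class is a limit of SIMPLE classes (so `simple` is not closed, re-derived with a kiss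
instead of the retrace of §4) — it is the kind of non-simple class a weak limit of self-avoiding
polygons can charge. -/
theorem mk_kiss_mem_closure_simple : CurveClass.mk kiss ∈ closure CurveClass.simple := by
  refine mem_closure_of_tendsto tendsto_mk_kissAt (Eventually.of_forall fun n => ?_)
  refine CurveClass.mk_mem_simple (kissAt_isSimple (by positivity) ?_)
  rw [div_lt_one (by positivity)]; linarith [n.cast_nonneg (α := ℝ)]

/-- The parameter set off the single sphere through the kiss point: `{(z, ρ, R) | dist 1 z ≠ R}`. -/
def kissParams : Set (ℂ × ℝ × ℝ) := {p | dist (1 : ℂ) p.1 ≠ p.2.2}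

theorem dense_kissParams : Dense kissParams := by
  intro x
  rw [Metric.mem_closure_iff]
  intro ε hε
  by_cases hx : x ∈ kissParams
  · exact ⟨x, hx, by rwa [dist_self]⟩
  · have hx' : dist (1 : ℂ) x.1 = x.2.2 := not_ne_iff.1 hx
    refine ⟨(x.1, x.2.1, x.2.2 + ε / 2), ?_, ?_⟩
    · show dist (1 : ℂ) x.1 ≠ x.2.2 + ε / 2
      rw [hx']; linarith
    · rw [Prod.dist_eq, Prod.dist_eq, dist_self, dist_self, Real.dist_eq]
      rw [show x.2.2 - (x.2.2 + ε / 2) = -(ε / 2) by ring, abs_neg, abs_of_pos (half_pos hε)]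
      rw [max_eq_right (half_pos hε).le, max_eq_right (half_pos hε).le]
      linarith

/-- **The kiss has no marked revisit at any parameter off one sphere.** An exact marked revisit
`kiss t' = kiss lam`, `lam < T < t'`, needs the double pair `(lam, t') = (1/8, 3/4)`, whose marked
point is the kiss point `1`, which lies on `sphere z R` only when `dist 1 z = R`. -/
theorem kiss_noMarkedRevisit {p : ℂ × ℝ × ℝ} (hp : p ∈ kissParams) {lam T : I}
    (hM : MarkedConfig kiss p.1 p.2.1 p.2.2 lam T) {t' : I} (hT : T < t') : kiss t' ≠ kiss lam := by
  intro heq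
  have hlt : lam < t' := hM.1.trans hT
  obtain ⟨hlam, -⟩ := kiss_eq_kiss hlt heq.symm
  have hsph := hM.2.1
  rw [kiss_apply_of_eq hlam, Metric.mem_sphere] at hsph
  exact hp hsph

/-- `NoMarkedRevisitFor` (the ORDER clause delivered by stubs 4–5 of the line) HOLDS for the Dirac
mass at the kiss class. -/
theorem noMarkedRevisitFor_dirac_kiss : NoMarkedRevisitFor (Measure.dirac (CurveClass.mk kiss)) := by
  refine ⟨kissParams, dense_kissParams, ?_⟩
  rw [ae_dirac_eq, eventually_pure]
  exact ⟨kiss, rfl, fun p hp lam T hM t' hT => kiss_noMarkedRevisit hp hM hT⟩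

/-- **ORDER WITHOUT SHAPE IS INSUFFICIENT (mirror of §7).** A probability measure on curve classes
satisfying the line's ORDER clause `NoMarkedRevisitFor`, carried by limits of simple classes, yet
giving mass `0` to `simple`: the Dirac mass at the kiss. The marked-point functional never sees a
KISS (a double point that is neither a retrace nor a crossing); only SHAPE (`HasArcRange`: the range
of a kiss contains a loop, so it is not an arc) excludes it. Since transversal CROSSINGS cannot arise
as uniform limits of simple planar curves but kisses and retraces can, the non-simple classes a
subsequential SAW limit may charge are retraces (caught by ORDER) and kisses (caught by SHAPE only):
in the line `marked-point-revisit` the A-side input `RangeIsArc` is load-bearing for SIMPLICITY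
itself, not only for the boundary clause — if `AvoidanceLimit` does not close, `OnePointNoTouch`-type
inputs cannot rescue the simplicity half of the crux. -/
theorem exists_noMarkedRevisitFor_not_ae_simple :
    ∃ ν : Measure (CurveClass ℂ), IsProbabilityMeasure ν ∧ NoMarkedRevisitFor ν ∧
      (∀ᵐ c ∂ν, c ∈ closure CurveClass.simple) ∧ ∀ᵐ c ∂ν, c ∉ CurveClass.simple :=
  ⟨Measure.dirac (CurveClass.mk kiss), inferInstance, noMarkedRevisitFor_dirac_kiss,
    by rw [ae_dirac_eq, eventually_pure]; exact mk_kiss_mem_closure_simple,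
    by rw [ae_dirac_eq, eventually_pure]; exact mk_kiss_not_mem_simple⟩

/-- The a.e.-simplicity conclusion of the crux FAILS for this ORDER-satisfying measure. -/
theorem not_ae_simple_dirac_kiss :
    ¬ ∀ᵐ c ∂(Measure.dirac (CurveClass.mk kiss)), c ∈ CurveClass.simple := by
  rw [ae_dirac_eq, eventually_pure]
  exact mk_kiss_not_mem_simple

end Kiss

/-! ## §16 NO STRENGTH WASTED: the line's two open stubs are CONSEQUENCES of the crux (gen 3)
(SHAPE outright; the lattice input `NoTouchAt` modulo `EventualTight`) -/

section StubsFromCrux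

/-- verbatim `HasArcRange` of the line `marked-point-revisit` (the SHAPE clause, one class at a time). -/
def HasArcRange (D : DobrushinDomain) (c : CurveClass ℂ) : Prop :=
  ∃ c' ∈ CurveClass.simple, c'.source = D.pt 0 ∧ c'.target = D.pt 1 ∧
    c'.range ⊆ closure D.carrier ∧ c'.range ∩ frontier D.carrier ⊆ {D.pt 0, D.pt 1} ∧
    c'.range = c.range

/-- SHAPE is implied by the crux: under `S` every subsequential limit has arc ranges a.e. (the class
itself is the witnessing chord). So `stub_rangeIsArc`'s OUTPUT is not over-strong. -/
theorem ae_hasArcRange_of_crux (hC : Crux) {D : DobrushinDomain} {a b : ℝ → Site 2}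
    (hab : IsEndpointApprox D a b) {s : ℕ → ℝ} {ν : Measure (CurveClass ℂ)}
    (hs : Tendsto s atTop (𝓝[>] (0 : ℝ))) (hν : IsProbabilityMeasure ν)
    (hw : WeakLimitAlong D a b s ν) : ∀ᵐ c ∂ν, HasArcRange D c := by
  filter_upwards [hC D a b hab s ν hs hν hw] with c hc
  exact ⟨c, hc.1, hc.2.1, hc.2.2.1, hc.2.2.2.1, hc.2.2.2.2, rfl⟩

/-- **The lattice input is NECESSARY for the crux, modulo tightness.** `S ∧ EventualTight ⇒ NoTouchAt`
along every endpoint approximation (any `R₁ ∈ (r, R)`, `R₂ > R`): if for every return radius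
`1/(n+1)` the `limsup` exceeded `θ`, pick meshes `δ_n < 1/(n+1)` with `P_{δ_n}(E_n) > θ`, extract a
weakly convergent subsequence (`exists_weakLimitAlong_of_eventualTight`, §8), and its limit `ν` —
carried by simple classes by `S` — would charge every closed enlargement `closure E_m` with mass
`≥ θ` (portmanteau), hence their intersection, which contains no simple class
(`not_mem_closure_nearRevisitEvent_forall_of_simple`, drefute). With the drefuter's
`noTouchAt_of_sawScalingLimit` (summit ⇒ stub) this pins the stub's truth value BETWEEN the crux+T
and the summit: the line wastes no strength, and `OnePointNoTouch` is exactly as hard as the ORDER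
half of `S` in the tight regime. -/
theorem noTouchAt_of_crux_of_eventualTight (hC : Crux)
    (hT : Summit.CriticalPhenomena.SAWScalingLimit.Theses.SAWLoopFugacityFlow.EventualTight)
    {D : DobrushinDomain} {a b : ℝ → Site 2} (hab : IsEndpointApprox D a b) : NoTouchAt D a b := by
  intro z r R hr hrR θ hθ
  set R₁ : ℝ := (r + R) / 2 with hR₁
  set R₂ : ℝ := R + 1 with hR₂
  have h₁ : r < R₁ := by rw [hR₁]; linarith
  have h₂ : R₁ < R := by rw [hR₁]; linarith
  have h₃ : R < R₂ := by rw [hR₂]; linarith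
  set E : ℕ → ℝ → ℝ≥0∞ := fun n δ => law D.carrier δ (a δ) (b δ)
      {γ | NearRevisit (latticeCurve γ) z r R₁ R₂ (1 / ((n : ℝ) + 1))} with hE
  suffices hex : ∃ n : ℕ, limsup (E n) (𝓝[>] (0 : ℝ)) ≤ θ by
    obtain ⟨n, hn⟩ := hex
    exact ⟨1 / ((n : ℝ) + 1), R₁, R₂, by positivity, h₁, h₂, h₃, hn⟩
  by_contra hcon
  push Not at hcon
  -- meshes `δ_n ∈ (0, 1/(n+1))` with `P_{δ_n}(E_n) > θ`
  have hpick : ∀ n : ℕ, ∃ δ : ℝ, θ < E n δ ∧ δ ∈ Ioo (0 : ℝ) (1 / ((n : ℝ) + 1)) := by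
    intro n
    have hfr : ∃ᶠ δ in 𝓝[>] (0 : ℝ), θ < E n δ := frequently_lt_of_lt_limsup (h := hcon n)
    exact (hfr.and_eventually (Ioo_mem_nhdsGT (by positivity))).exists
  choose d hd using hpick
  have hd0 : ∀ n, 0 < d n := fun n => (hd n).2.1
  have hds : Tendsto d atTop (𝓝[>] (0 : ℝ)) := by
    rw [tendsto_nhdsWithin_iff]
    refine ⟨?_, Eventually.of_forall fun n => hd0 n⟩
    exact squeeze_zero (fun n => (hd0 n).le) (fun n => (hd n).2.2.le)
      tendsto_one_div_add_atTop_nhds_zero_nat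
  obtain ⟨φ, ν, hφ, hν, hw⟩ := exists_weakLimitAlong_of_eventualTight hT hab hds
  haveI := hν
  have hsφ : Tendsto (d ∘ φ) atTop (𝓝[>] (0 : ℝ)) := hds.comp hφ.tendsto_atTop
  have hcar := hC D a b hab (d ∘ φ) ν hsφ hν hw
  -- closed enlargements with null intersection under `ν`
  set F : ℕ → Set (CurveClass ℂ) := fun n =>
    closure (nearRevisitEvent z r R₁ R₂ (1 / ((n : ℝ) + 1))) with hF
  have hanti : Antitone F := by
    intro m n hmn
    have hmn' : (m : ℝ) ≤ n := by exact_mod_cast hmn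
    refine closure_mono ?_
    rintro c ⟨γ, rfl, hγ⟩
    exact ⟨γ, rfl, nearRevisit_mono hγ (one_div_le_one_div_of_le (by positivity) (by linarith))⟩
  have hlimF := tendsto_measure_iInter_atTop (μ := ν)
    (fun n : ℕ => (isClosed_closure : IsClosed (F n)).measurableSet.nullMeasurableSet)
    hanti ⟨0, measure_ne_top ν _⟩
  have h0 : ν (⋂ n : ℕ, F n) = 0 := by
    rw [ae_iff] at hcar
    refine measure_mono_null (fun c hc => ?_) hcar
    intro hcar'
    exact not_mem_closure_nearRevisitEvent_forall_of_simple h₁ hcar'.1 (mem_iInter.1 hc)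
  rw [h0] at hlimF
  obtain ⟨m, hm⟩ := ((tendsto_order.1 hlimF).2 θ hθ).exists
  -- portmanteau for the closed set `F m` along the subsequence
  let μs : ℕ → FiniteMeasure (CurveClass ℂ) := fun k =>
    ⟨(law D.carrier ((d ∘ φ) k) (a ((d ∘ φ) k)) (b ((d ∘ φ) k))).map (fun γ => γ.curve),
      inferInstance⟩
  let μf : FiniteMeasure (CurveClass ℂ) := ⟨ν, inferInstance⟩
  have hlim : Tendsto μs atTop (𝓝 μf) := by
    rw [FiniteMeasure.tendsto_iff_forall_integral_tendsto]
    intro f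
    refine (hw f).congr fun k => ?_
    change _ = ∫ x, f x ∂((law D.carrier ((d ∘ φ) k) (a ((d ∘ φ) k)) (b ((d ∘ φ) k))).map
      (fun γ => γ.curve))
    rw [integral_map (DomainSAW.measurable_of_top _).aemeasurable
      f.continuous.aestronglyMeasurable]
  have hport := FiniteMeasure.limsup_measure_closed_le_of_tendsto hlim
    (isClosed_closure : IsClosed (F m))
  -- along the subsequence, eventually `P(E_{φ k}) > θ` and `E_{φ k} ⊆ {curve ∈ F m}`
  have hev : ∀ᶠ k in atTop,
      θ < ((μs k : FiniteMeasure (CurveClass ℂ)) : Measure (CurveClass ℂ)) (F m) := by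
    filter_upwards [eventually_ge_atTop m] with k hk
    have hφk : m ≤ φ k := hk.trans (hφ.id_le k)
    have hmk : (m : ℝ) ≤ φ k := by exact_mod_cast hφk
    refine (hd (φ k)).1.trans_le ?_
    change law D.carrier (d (φ k)) (a (d (φ k))) (b (d (φ k)))
        {γ | NearRevisit (latticeCurve γ) z r R₁ R₂ (1 / (((φ k : ℕ) : ℝ) + 1))} ≤
      ((law D.carrier (d (φ k)) (a (d (φ k))) (b (d (φ k)))).map (fun γ => γ.curve)) (F m)
    rw [Measure.map_apply (DomainSAW.measurable_of_top _)
      (isClosed_closure : IsClosed (F m)).measurableSet]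
    refine measure_mono fun γ hγ => ?_
    show γ.curve ∈ F m
    rw [← mk_latticeCurve]
    exact subset_closure ⟨latticeCurve γ, rfl,
      nearRevisit_mono hγ (one_div_le_one_div_of_le (by positivity) (by linarith))⟩
  have hle : θ ≤ limsup (fun k =>
      ((μs k : FiniteMeasure (CurveClass ℂ)) : Measure (CurveClass ℂ)) (F m)) atTop :=
    le_limsup_of_frequently_le (hev.frequently.mono fun k hk => hk.le)
  exact absurd (hle.trans hport) (not_le.2 hm)

/-- Packaged: in the tight regime the hardest stub's statement is a consequence of the crux. -/
theorem stub_onePointNoTouch_of_crux_of_eventualTight (hC : Crux)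
    (hT : Summit.CriticalPhenomena.SAWScalingLimit.Theses.SAWLoopFugacityFlow.EventualTight) :
    ∀ (D : DobrushinDomain) (a b : ℝ → Site 2), IsEndpointApprox D a b → NoTouchAt D a b :=
  fun _ _ _ hab => noTouchAt_of_crux_of_eventualTight hC hT hab

end StubsFromCrux

end Summit.CriticalPhenomena.SAWScalingLimit.Cruxes.SimpleSubseqLimits.Disproof
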